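import Summits.AnomalousDissipation.AnomalousDissipation.Theorems.SawtoothPulseCascadeK1LocalisedCascadeKHPieceResponse
import Summits.AnomalousDissipation.AnomalousDissipation.Theorems.SawtoothPulseCascadeK1LocalisedCascadeKHForcingClosedForm

/-!
# K2 lane (route-2 `SawtoothPulseCascade`, crux dir `K1LocalisedCascade`): response of the stable kink-sheet block to the SINGLE-MODE SOURCE — the twelve-term bound

Helper file of the K2 lane (ACL item stmt-AnomalousDissipation-19491; S2-cert forced part / P1″, A26-4 (a)). Combines the closed form of the single-mode source
(`…KHForcingClosedForm`) with the piece response (`…KHPieceResponse`): for `a > 0`, `θ ≥ 0` and a block rate `ω` off the three resonances `0, ±πa/2`,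
the Duhamel integral of the source at a kink line against a propagator entry `cos(ω(θ−s))` / `sin(ω(θ−s))/ω` is bounded by the SUM OF TWELVE explicit
per-term bounds (3 pieces × 2 kernel exponentials × 2 end points), uniformly in `θ` and in the mode `ξ`:
* `src_quarter_pieces` / `src_negQuarter_pieces`: the closed form rewritten as three pieces in Lorentzian-ready shape (`μ = ±2πa`, `ν₀ = 2πξ`, `ν = ±2πa`,
  phases `πa, 0, −πa`);
* `norm_integral_three_le`: splitting a kernel integral over three pieces;
* `norm_integral_cos_src_quarter_le`, `norm_integral_sin_src_quarter_le`, and the `negQuarter` versions (sequel file `…KHSourceResponseNeg` if split).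
With `…KHStableDetuning` / `…KHStableRotation` (`ω ∈ [0.55a, πa/2 − 399/401]` for `a ≥ 1`) every detuning is `≥ 399/401` or `≥ 0.55`, so each term is
`O(1/a²)` times the coupling `4πa`: the single-mode creation amplitude is `O(1/a)` (p4's `StableBlockCreation` law; the numeric corollary is the next file).
No definitions; no statement about the crux. [cite: Drazin2002, §8.3 (8.36)–(8.38)] [problem: turb]
-/

-- `Summit.<Summit>.<Problem>`: single-conjunct summit, the duplicate namespace segment is deliberate.
set_option linter.dupNamespace false

noncomputable section

namespace Summit.AnomalousDissipation.AnomalousDissipation.Theorems.SawtoothPulseCascade.K2PhaseBudget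

open Set MeasureTheory intervalIntegral Literature.Analysis.FluidPDE.SawtoothCascade

/-- Splitting a kernel integral over three pieces: `‖∫ k(P₁+P₂+P₃)‖ ≤ ‖∫kP₁‖ + ‖∫kP₂‖ + ‖∫kP₃‖`. [folklore] -/
theorem norm_integral_three_le {k P₁ P₂ P₃ : ℝ → ℂ} {a b : ℝ}
    (h₁ : IntervalIntegrable (fun s => k s * P₁ s) volume a b) (h₂ : IntervalIntegrable (fun s => k s * P₂ s) volume a b)
    (h₃ : IntervalIntegrable (fun s => k s * P₃ s) volume a b) :
    ‖∫ s in a..b, k s * (P₁ s + P₂ s + P₃ s)‖ ≤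
      ‖∫ s in a..b, k s * P₁ s‖ + ‖∫ s in a..b, k s * P₂ s‖ + ‖∫ s in a..b, k s * P₃ s‖ := by
  have e : ∫ s in a..b, k s * (P₁ s + P₂ s + P₃ s) =
      ((∫ s in a..b, k s * P₁ s) + ∫ s in a..b, k s * P₂ s) + ∫ s in a..b, k s * P₃ s := by
    rw [← intervalIntegral.integral_add h₁ h₂, ← intervalIntegral.integral_add (h₁.add h₂) h₃]
    refine intervalIntegral.integral_congr fun s _ => ?_
    ring
  rw [e]
  exact (norm_add_le _ _).trans (add_le_add (norm_add_le _ _) le_rfl)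

section source

variable {a : ℝ} {K G : ℝ → ℂ}


/-- The closed form of the source at `y₀ = ¼` as three PIECES in Lorentzian-ready shape (`μ = ±2πa`, `ν₀ = 2πξ`, `ν = ±2πa`,
phases `φ₀ = πa, 0, −πa`). [cite: Drazin2002, §8.3 (8.36)–(8.38)] -/
theorem src_quarter_pieces (ha : 0 < a) (β ξ : ℝ)
    (hK : K = fun r : ℝ => (-((Real.exp (-(2 * Real.pi * a * r)) : ℂ) /
            (1 - starRingEnd ℂ (Complex.exp (2 * Real.pi * β * Complex.I)) * (Real.exp (-(2 * Real.pi * a)) : ℂ))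
          + (Real.exp (2 * Real.pi * a * (r - 1)) : ℂ) * Complex.exp (2 * Real.pi * β * Complex.I) /
            (1 - Complex.exp (2 * Real.pi * β * Complex.I) * (Real.exp (-(2 * Real.pi * a)) : ℂ))) /
        (2 * (2 * Real.pi * a) : ℂ)))
    (hG : ∀ u : ℝ, G u = Complex.exp (2 * Real.pi * β * (⌊u⌋ : ℝ) * Complex.I) * K (u - ⌊u⌋)) (s : ℝ) :
    ∫ y in (-(1 / 2 : ℝ))..(1 / 2 : ℝ), G ((1 / 4 : ℝ) - y) * Complex.exp (((2 * Real.pi * ξ * y : ℝ) : ℂ) * Complex.I) * Complex.exp (-((2 * Real.pi * a * s * triWave y : ℝ) : ℂ) * Complex.I) =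
      (Complex.exp ((((Real.pi * a) * s : ℝ)) * Complex.I) *
          (((1 : ℂ) * (-1 / ((1 - starRingEnd ℂ (Complex.exp (2 * Real.pi * β * Complex.I)) * (Real.exp (-(2 * Real.pi * a)) : ℂ)) * (2 * (2 * Real.pi * a)))) * Complex.exp (-((2 * Real.pi * a : ℝ) : ℂ) * (1 / 4 : ℝ))) * ((Complex.exp ((((((2 * Real.pi * a) : ℝ)) : ℂ) + ((((2 * Real.pi * ξ) + (2 * Real.pi * a) * s : ℝ)) : ℂ) * Complex.I) * (((-(1 / 4 : ℝ)) : ℝ) : ℂ)) - Complex.exp ((((((2 * Real.pi * a) : ℝ)) : ℂ) + ((((2 * Real.pi * ξ) + (2 * Real.pi * a) * s : ℝ)) : ℂ) * Complex.I) * (((-(1 / 2 : ℝ)) : ℝ) : ℂ))) / (((((2 * Real.pi * a) : ℝ)) : ℂ) + ((((2 * Real.pi * ξ) + (2 * Real.pi * a) * s : ℝ)) : ℂ) * Complex.I)) +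
           ((1 : ℂ) * (-(Complex.exp (2 * Real.pi * β * Complex.I) * (Real.exp (-(2 * Real.pi * a)) : ℂ)) / ((1 - Complex.exp (2 * Real.pi * β * Complex.I) * (Real.exp (-(2 * Real.pi * a)) : ℂ)) * (2 * (2 * Real.pi * a)))) * Complex.exp (((2 * Real.pi * a : ℝ) : ℂ) * (1 / 4 : ℝ))) * ((Complex.exp ((((((-(2 * Real.pi * a)) : ℝ)) : ℂ) + ((((2 * Real.pi * ξ) + (2 * Real.pi * a) * s : ℝ)) : ℂ) * Complex.I) * (((-(1 / 4 : ℝ)) : ℝ) : ℂ)) - Complex.exp ((((((-(2 * Real.pi * a)) : ℝ)) : ℂ) + ((((2 * Real.pi * ξ) + (2 * Real.pi * a) * s : ℝ)) : ℂ) * Complex.I) * (((-(1 / 2 : ℝ)) : ℝ) : ℂ))) / (((((-(2 * Real.pi * a)) : ℝ)) : ℂ) + ((((2 * Real.pi * ξ) + (2 * Real.pi * a) * s : ℝ)) : ℂ) * Complex.I)))) +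
        (Complex.exp ((((0 : ℝ) * s : ℝ)) * Complex.I) *
          (((1 : ℂ) * (-1 / ((1 - starRingEnd ℂ (Complex.exp (2 * Real.pi * β * Complex.I)) * (Real.exp (-(2 * Real.pi * a)) : ℂ)) * (2 * (2 * Real.pi * a)))) * Complex.exp (-((2 * Real.pi * a : ℝ) : ℂ) * (1 / 4 : ℝ))) * ((Complex.exp ((((((2 * Real.pi * a) : ℝ)) : ℂ) + ((((2 * Real.pi * ξ) + (-(2 * Real.pi * a)) * s : ℝ)) : ℂ) * Complex.I) * (((1 / 4 : ℝ) : ℝ) : ℂ)) - Complex.exp ((((((2 * Real.pi * a) : ℝ)) : ℂ) + ((((2 * Real.pi * ξ) + (-(2 * Real.pi * a)) * s : ℝ)) : ℂ) * Complex.I) * (((-(1 / 4 : ℝ)) : ℝ) : ℂ))) / (((((2 * Real.pi * a) : ℝ)) : ℂ) + ((((2 * Real.pi * ξ) + (-(2 * Real.pi * a)) * s : ℝ)) : ℂ) * Complex.I)) +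
           ((1 : ℂ) * (-(Complex.exp (2 * Real.pi * β * Complex.I) * (Real.exp (-(2 * Real.pi * a)) : ℂ)) / ((1 - Complex.exp (2 * Real.pi * β * Complex.I) * (Real.exp (-(2 * Real.pi * a)) : ℂ)) * (2 * (2 * Real.pi * a)))) * Complex.exp (((2 * Real.pi * a : ℝ) : ℂ) * (1 / 4 : ℝ))) * ((Complex.exp ((((((-(2 * Real.pi * a)) : ℝ)) : ℂ) + ((((2 * Real.pi * ξ) + (-(2 * Real.pi * a)) * s : ℝ)) : ℂ) * Complex.I) * (((1 / 4 : ℝ) : ℝ) : ℂ)) - Complex.exp ((((((-(2 * Real.pi * a)) : ℝ)) : ℂ) + ((((2 * Real.pi * ξ) + (-(2 * Real.pi * a)) * s : ℝ)) : ℂ) * Complex.I) * (((-(1 / 4 : ℝ)) : ℝ) : ℂ))) / (((((-(2 * Real.pi * a)) : ℝ)) : ℂ) + ((((2 * Real.pi * ξ) + (-(2 * Real.pi * a)) * s : ℝ)) : ℂ) * Complex.I)))) +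
        (Complex.exp ((((-(Real.pi * a)) * s : ℝ)) * Complex.I) *
          (((starRingEnd ℂ (Complex.exp (2 * Real.pi * β * Complex.I))) * (-1 / ((1 - starRingEnd ℂ (Complex.exp (2 * Real.pi * β * Complex.I)) * (Real.exp (-(2 * Real.pi * a)) : ℂ)) * (2 * (2 * Real.pi * a)))) * Complex.exp (-((2 * Real.pi * a : ℝ) : ℂ) * (5 / 4 : ℝ))) * ((Complex.exp ((((((2 * Real.pi * a) : ℝ)) : ℂ) + ((((2 * Real.pi * ξ) + (2 * Real.pi * a) * s : ℝ)) : ℂ) * Complex.I) * (((1 / 2 : ℝ) : ℝ) : ℂ)) - Complex.exp ((((((2 * Real.pi * a) : ℝ)) : ℂ) + ((((2 * Real.pi * ξ) + (2 * Real.pi * a) * s : ℝ)) : ℂ) * Complex.I) * (((1 / 4 : ℝ) : ℝ) : ℂ))) / (((((2 * Real.pi * a) : ℝ)) : ℂ) + ((((2 * Real.pi * ξ) + (2 * Real.pi * a) * s : ℝ)) : ℂ) * Complex.I)) +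
           ((starRingEnd ℂ (Complex.exp (2 * Real.pi * β * Complex.I))) * (-(Complex.exp (2 * Real.pi * β * Complex.I) * (Real.exp (-(2 * Real.pi * a)) : ℂ)) / ((1 - Complex.exp (2 * Real.pi * β * Complex.I) * (Real.exp (-(2 * Real.pi * a)) : ℂ)) * (2 * (2 * Real.pi * a)))) * Complex.exp (((2 * Real.pi * a : ℝ) : ℂ) * (5 / 4 : ℝ))) * ((Complex.exp ((((((-(2 * Real.pi * a)) : ℝ)) : ℂ) + ((((2 * Real.pi * ξ) + (2 * Real.pi * a) * s : ℝ)) : ℂ) * Complex.I) * (((1 / 2 : ℝ) : ℝ) : ℂ)) - Complex.exp ((((((-(2 * Real.pi * a)) : ℝ)) : ℂ) + ((((2 * Real.pi * ξ) + (2 * Real.pi * a) * s : ℝ)) : ℂ) * Complex.I) * (((1 / 4 : ℝ) : ℝ) : ℂ))) / (((((-(2 * Real.pi * a)) : ℝ)) : ℂ) + ((((2 * Real.pi * ξ) + (2 * Real.pi * a) * s : ℝ)) : ℂ) * Complex.I)))) := by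
  rw [forcing_src_quarter ha β ξ s hK hG, show Complex.exp ((((0 : ℝ) * s : ℝ)) * Complex.I) = (1 : ℂ) by simp]
  have e1 : ((2 * Real.pi * (ξ + a * s) : ℝ) : ℂ) = (((2 * Real.pi * ξ) + (2 * Real.pi * a) * s : ℝ) : ℂ) := by push_cast; ring
  have e2 : ((2 * Real.pi * (ξ - a * s) : ℝ) : ℂ) = (((2 * Real.pi * ξ) + (-(2 * Real.pi * a)) * s : ℝ) : ℂ) := by push_cast; ring
  have e3 : -((2 * Real.pi * a : ℝ) : ℂ) = (((-(2 * Real.pi * a)) : ℝ) : ℂ) := by push_cast; ring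
  have e5 : Complex.exp (-((Real.pi * a * s : ℝ) : ℂ) * Complex.I) = Complex.exp ((((-(Real.pi * a)) * s : ℝ)) * Complex.I) := by
    congr 1; push_cast; ring
  rw [e1, e2, e3, e5]
  push_cast
  ring_nf


/-- **Response of the `cos` propagator entry to the single-mode source at `y₀ = ¼`** (`a > 0`, `θ ≥ 0`, `ω ∉ {0, ±πa/2}`): the twelve-term bound,
uniform in `θ` and `ξ`. [cite: Drazin2002, §8.3 (8.36)–(8.38)] -/
theorem norm_integral_cos_src_quarter_le (ha : 0 < a) (β ξ : ℝ) {ω θ : ℝ} (hθ : 0 ≤ θ) (hω : ω ≠ 0)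
    (hω1 : Real.pi * a / 2 - ω ≠ 0) (hω2 : Real.pi * a / 2 + ω ≠ 0)
    (hK : K = fun r : ℝ => (-((Real.exp (-(2 * Real.pi * a * r)) : ℂ) /
            (1 - starRingEnd ℂ (Complex.exp (2 * Real.pi * β * Complex.I)) * (Real.exp (-(2 * Real.pi * a)) : ℂ))
          + (Real.exp (2 * Real.pi * a * (r - 1)) : ℂ) * Complex.exp (2 * Real.pi * β * Complex.I) /
            (1 - Complex.exp (2 * Real.pi * β * Complex.I) * (Real.exp (-(2 * Real.pi * a)) : ℂ))) /
        (2 * (2 * Real.pi * a) : ℂ)))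
    (hG : ∀ u : ℝ, G u = Complex.exp (2 * Real.pi * β * (⌊u⌋ : ℝ) * Complex.I) * K (u - ⌊u⌋)) :
    ‖∫ s in (0 : ℝ)..θ, (Real.cos (ω * (θ - s)) : ℂ) *
        ∫ y in (-(1 / 2 : ℝ))..(1 / 2 : ℝ), G ((1 / 4 : ℝ) - y) * Complex.exp (((2 * Real.pi * ξ * y : ℝ) : ℂ) * Complex.I) * Complex.exp (-((2 * Real.pi * a * s * triWave y : ℝ) : ℂ) * Complex.I)‖ ≤
      ((‖((1 : ℂ) * (-1 / ((1 - starRingEnd ℂ (Complex.exp (2 * Real.pi * β * Complex.I)) * (Real.exp (-(2 * Real.pi * a)) : ℂ)) * (2 * (2 * Real.pi * a)))) * Complex.exp (-((2 * Real.pi * a : ℝ) : ℂ) * (1 / 4 : ℝ)))‖ * Real.exp ((2 * Real.pi * a) * (-(1 / 4 : ℝ))) * (2 + Real.pi) / |(2 * Real.pi * a)| * (1 / |(Real.pi * a) + (2 * Real.pi * a) * (-(1 / 4 : ℝ)) - ω| + 1 / |(Real.pi * a) + (2 * Real.pi * a) * (-(1 / 4 : ℝ)) + ω|) * (1 / 2)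 +
        ‖((1 : ℂ) * (-1 / ((1 - starRingEnd ℂ (Complex.exp (2 * Real.pi * β * Complex.I)) * (Real.exp (-(2 * Real.pi * a)) : ℂ)) * (2 * (2 * Real.pi * a)))) * Complex.exp (-((2 * Real.pi * a : ℝ) : ℂ) * (1 / 4 : ℝ)))‖ * Real.exp ((2 * Real.pi * a) * (-(1 / 2 : ℝ))) * (2 + Real.pi) / |(2 * Real.pi * a)| * (1 / |(Real.pi * a) + (2 * Real.pi * a) * (-(1 / 2 : ℝ)) - ω| + 1 / |(Real.pi * a) + (2 * Real.pi * a) * (-(1 / 2 : ℝ)) + ω|) * (1 / 2)) +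
      (‖((1 : ℂ) * (-(Complex.exp (2 * Real.pi * β * Complex.I) * (Real.exp (-(2 * Real.pi * a)) : ℂ)) / ((1 - Complex.exp (2 * Real.pi * β * Complex.I) * (Real.exp (-(2 * Real.pi * a)) : ℂ)) * (2 * (2 * Real.pi * a)))) * Complex.exp (((2 * Real.pi * a : ℝ) : ℂ) * (1 / 4 : ℝ)))‖ * Real.exp ((-(2 * Real.pi * a)) * (-(1 / 4 : ℝ))) * (2 + Real.pi) / |(-(2 * Real.pi * a))| * (1 / |(Real.pi * a) + (2 * Real.pi * a) * (-(1 / 4 : ℝ)) - ω| + 1 / |(Real.pi * a) + (2 * Real.pi * a) * (-(1 / 4 : ℝ)) + ω|) * (1 / 2) +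
        ‖((1 : ℂ) * (-(Complex.exp (2 * Real.pi * β * Complex.I) * (Real.exp (-(2 * Real.pi * a)) : ℂ)) / ((1 - Complex.exp (2 * Real.pi * β * Complex.I) * (Real.exp (-(2 * Real.pi * a)) : ℂ)) * (2 * (2 * Real.pi * a)))) * Complex.exp (((2 * Real.pi * a : ℝ) : ℂ) * (1 / 4 : ℝ)))‖ * Real.exp ((-(2 * Real.pi * a)) * (-(1 / 2 : ℝ))) * (2 + Real.pi) / |(-(2 * Real.pi * a))| * (1 / |(Real.pi * a) + (2 * Real.pi * a) * (-(1 / 2 : ℝ)) - ω| + 1 / |(Real.pi * a) + (2 * Real.pi * a) * (-(1 / 2 : ℝ)) + ω|) * (1 / 2))) +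
      ((‖((1 : ℂ) * (-1 / ((1 - starRingEnd ℂ (Complex.exp (2 * Real.pi * β * Complex.I)) * (Real.exp (-(2 * Real.pi * a)) : ℂ)) * (2 * (2 * Real.pi * a)))) * Complex.exp (-((2 * Real.pi * a : ℝ) : ℂ) * (1 / 4 : ℝ)))‖ * Real.exp ((2 * Real.pi * a) * (1 / 4 : ℝ)) * (2 + Real.pi) / |(2 * Real.pi * a)| * (1 / |(0 : ℝ) + (-(2 * Real.pi * a)) * (1 / 4 : ℝ) - ω| + 1 / |(0 : ℝ) + (-(2 * Real.pi * a)) * (1 / 4 : ℝ) + ω|) * (1 / 2) +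
        ‖((1 : ℂ) * (-1 / ((1 - starRingEnd ℂ (Complex.exp (2 * Real.pi * β * Complex.I)) * (Real.exp (-(2 * Real.pi * a)) : ℂ)) * (2 * (2 * Real.pi * a)))) * Complex.exp (-((2 * Real.pi * a : ℝ) : ℂ) * (1 / 4 : ℝ)))‖ * Real.exp ((2 * Real.pi * a) * (-(1 / 4 : ℝ))) * (2 + Real.pi) / |(2 * Real.pi * a)| * (1 / |(0 : ℝ) + (-(2 * Real.pi * a)) * (-(1 / 4 : ℝ)) - ω| + 1 / |(0 : ℝ) + (-(2 * Real.pi * a)) * (-(1 / 4 : ℝ)) + ω|) * (1 / 2)) +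
      (‖((1 : ℂ) * (-(Complex.exp (2 * Real.pi * β * Complex.I) * (Real.exp (-(2 * Real.pi * a)) : ℂ)) / ((1 - Complex.exp (2 * Real.pi * β * Complex.I) * (Real.exp (-(2 * Real.pi * a)) : ℂ)) * (2 * (2 * Real.pi * a)))) * Complex.exp (((2 * Real.pi * a : ℝ) : ℂ) * (1 / 4 : ℝ)))‖ * Real.exp ((-(2 * Real.pi * a)) * (1 / 4 : ℝ)) * (2 + Real.pi) / |(-(2 * Real.pi * a))| * (1 / |(0 : ℝ) + (-(2 * Real.pi * a)) * (1 / 4 : ℝ) - ω| + 1 / |(0 : ℝ) + (-(2 * Real.pi * a)) * (1 / 4 : ℝ) + ω|) * (1 / 2) +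
        ‖((1 : ℂ) * (-(Complex.exp (2 * Real.pi * β * Complex.I) * (Real.exp (-(2 * Real.pi * a)) : ℂ)) / ((1 - Complex.exp (2 * Real.pi * β * Complex.I) * (Real.exp (-(2 * Real.pi * a)) : ℂ)) * (2 * (2 * Real.pi * a)))) * Complex.exp (((2 * Real.pi * a : ℝ) : ℂ) * (1 / 4 : ℝ)))‖ * Real.exp ((-(2 * Real.pi * a)) * (-(1 / 4 : ℝ))) * (2 + Real.pi) / |(-(2 * Real.pi * a))| * (1 / |(0 : ℝ) + (-(2 * Real.pi * a)) * (-(1 / 4 : ℝ)) - ω| + 1 / |(0 : ℝ) + (-(2 * Real.pi * a)) * (-(1 / 4 : ℝ)) + ω|) * (1 / 2))) +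
      ((‖((starRingEnd ℂ (Complex.exp (2 * Real.pi * β * Complex.I))) * (-1 / ((1 - starRingEnd ℂ (Complex.exp (2 * Real.pi * β * Complex.I)) * (Real.exp (-(2 * Real.pi * a)) : ℂ)) * (2 * (2 * Real.pi * a)))) * Complex.exp (-((2 * Real.pi * a : ℝ) : ℂ) * (5 / 4 : ℝ)))‖ * Real.exp ((2 * Real.pi * a) * (1 / 2 : ℝ)) * (2 + Real.pi) / |(2 * Real.pi * a)| * (1 / |(-(Real.pi * a)) + (2 * Real.pi * a) * (1 / 2 : ℝ) - ω| + 1 / |(-(Real.pi * a)) + (2 * Real.pi * a) * (1 / 2 : ℝ) + ω|) * (1 / 2) +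
        ‖((starRingEnd ℂ (Complex.exp (2 * Real.pi * β * Complex.I))) * (-1 / ((1 - starRingEnd ℂ (Complex.exp (2 * Real.pi * β * Complex.I)) * (Real.exp (-(2 * Real.pi * a)) : ℂ)) * (2 * (2 * Real.pi * a)))) * Complex.exp (-((2 * Real.pi * a : ℝ) : ℂ) * (5 / 4 : ℝ)))‖ * Real.exp ((2 * Real.pi * a) * (1 / 4 : ℝ)) * (2 + Real.pi) / |(2 * Real.pi * a)| * (1 / |(-(Real.pi * a)) + (2 * Real.pi * a) * (1 / 4 : ℝ) - ω| + 1 / |(-(Real.pi * a)) + (2 * Real.pi * a) * (1 / 4 : ℝ) + ω|) * (1 / 2)) +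
      (‖((starRingEnd ℂ (Complex.exp (2 * Real.pi * β * Complex.I))) * (-(Complex.exp (2 * Real.pi * β * Complex.I) * (Real.exp (-(2 * Real.pi * a)) : ℂ)) / ((1 - Complex.exp (2 * Real.pi * β * Complex.I) * (Real.exp (-(2 * Real.pi * a)) : ℂ)) * (2 * (2 * Real.pi * a)))) * Complex.exp (((2 * Real.pi * a : ℝ) : ℂ) * (5 / 4 : ℝ)))‖ * Real.exp ((-(2 * Real.pi * a)) * (1 / 2 : ℝ)) * (2 + Real.pi) / |(-(2 * Real.pi * a))| * (1 / |(-(Real.pi * a)) + (2 * Real.pi * a) * (1 / 2 : ℝ) - ω| + 1 / |(-(Real.pi * a)) + (2 * Real.pi * a) * (1 / 2 : ℝ) + ω|) * (1 / 2) +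
        ‖((starRingEnd ℂ (Complex.exp (2 * Real.pi * β * Complex.I))) * (-(Complex.exp (2 * Real.pi * β * Complex.I) * (Real.exp (-(2 * Real.pi * a)) : ℂ)) / ((1 - Complex.exp (2 * Real.pi * β * Complex.I) * (Real.exp (-(2 * Real.pi * a)) : ℂ)) * (2 * (2 * Real.pi * a)))) * Complex.exp (((2 * Real.pi * a : ℝ) : ℂ) * (5 / 4 : ℝ)))‖ * Real.exp ((-(2 * Real.pi * a)) * (1 / 4 : ℝ)) * (2 + Real.pi) / |(-(2 * Real.pi * a))| * (1 / |(-(Real.pi * a)) + (2 * Real.pi * a) * (1 / 4 : ℝ) - ω| + 1 / |(-(Real.pi * a)) + (2 * Real.pi * a) * (1 / 4 : ℝ) + ω|) * (1 / 2))) := by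
  have hμ1 : (2 * Real.pi * a : ℝ) ≠ 0 := by positivity
  have hμ2 : (-(2 * Real.pi * a) : ℝ) ≠ 0 := by
    have : (0:ℝ) < 2 * Real.pi * a := by positivity
    linarith
  simp_rw [src_quarter_pieces ha β ξ hK hG]
  have hc : ∀ (φ₀ : ℝ) (c₁ c₂ : ℂ) (ν y₁ y₂ : ℝ), Continuous fun s : ℝ => (Real.cos (ω * (θ - s)) : ℂ) *
      (Complex.exp (((φ₀ * s : ℝ)) * Complex.I) *
        (c₁ * ((Complex.exp ((((((2 * Real.pi * a) : ℝ)) : ℂ) + ((((2 * Real.pi * ξ) + ν * s : ℝ)) : ℂ) * Complex.I) * y₂) - Complex.exp ((((((2 * Real.pi * a) : ℝ)) : ℂ) + ((((2 * Real.pi * ξ) + ν * s : ℝ)) : ℂ) * Complex.I) * y₁)) / (((((2 * Real.pi * a) : ℝ)) : ℂ) + ((((2 * Real.pi * ξ) + ν * s : ℝ)) : ℂ) * Complex.I)) +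
         c₂ * ((Complex.exp ((((((-(2 * Real.pi * a)) : ℝ)) : ℂ) + ((((2 * Real.pi * ξ) + ν * s : ℝ)) : ℂ) * Complex.I) * y₂) - Complex.exp ((((((-(2 * Real.pi * a)) : ℝ)) : ℂ) + ((((2 * Real.pi * ξ) + ν * s : ℝ)) : ℂ) * Complex.I) * y₁)) / (((((-(2 * Real.pi * a)) : ℝ)) : ℂ) + ((((2 * Real.pi * ξ) + ν * s : ℝ)) : ℂ) * Complex.I)))) := by
    intro φ₀ c₁ c₂ ν y₁ y₂
    have d1 : ∀ s : ℝ, ((((2 * Real.pi * a) : ℝ)) : ℂ) + ((((2 * Real.pi * ξ) + ν * s : ℝ)) : ℂ) * Complex.I ≠ 0 := fun s => lorentz_denom_ne_zero hμ1 _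
    have d2 : ∀ s : ℝ, ((((-(2 * Real.pi * a)) : ℝ)) : ℂ) + ((((2 * Real.pi * ξ) + ν * s : ℝ)) : ℂ) * Complex.I ≠ 0 := fun s => lorentz_denom_ne_zero hμ2 _
    refine Continuous.mul (by fun_prop) (Continuous.mul (by fun_prop) (Continuous.add ?_ ?_))
    · exact continuous_const.mul (Continuous.div (by fun_prop) (by fun_prop) d1)
    · exact continuous_const.mul (Continuous.div (by fun_prop) (by fun_prop) d2)
  refine (norm_integral_three_le ?_ ?_ ?_).trans ?_
  · exact (hc (Real.pi * a) (((1 : ℂ) * (-1 / ((1 - starRingEnd ℂ (Complex.exp (2 * Real.pi * β * Complex.I)) * (Real.exp (-(2 * Real.pi * a)) : ℂ)) * (2 * (2 * Real.pi * a)))) * Complex.exp (-((2 * Real.pi * a : ℝ) : ℂ) * (1 / 4 : ℝ)))) (((1 : ℂ) * (-(Complex.exp (2 * Real.pi * β * Complex.I) * (Real.exp (-(2 * Real.pi * a)) : ℂ)) / ((1 - Complex.exp (2 * Real.pi * β * Complex.I) * (Real.exp (-(2 * Real.pi * a)) : ℂ)) * (2 * (2 * Real.pi * a)))) * Complex.exp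 (((2 * Real.pi * a : ℝ) : ℂ) * (1 / 4 : ℝ)))) (2 * Real.pi * a) (-(1 / 2 : ℝ)) (-(1 / 4 : ℝ))).intervalIntegrable (μ := volume) _ _
  · exact (hc (0 : ℝ) (((1 : ℂ) * (-1 / ((1 - starRingEnd ℂ (Complex.exp (2 * Real.pi * β * Complex.I)) * (Real.exp (-(2 * Real.pi * a)) : ℂ)) * (2 * (2 * Real.pi * a)))) * Complex.exp (-((2 * Real.pi * a : ℝ) : ℂ) * (1 / 4 : ℝ)))) (((1 : ℂ) * (-(Complex.exp (2 * Real.pi * β * Complex.I) * (Real.exp (-(2 * Real.pi * a)) : ℂ)) / ((1 - Complex.exp (2 * Real.pi * β * Complex.I) * (Real.exp (-(2 * Real.pi * a)) : ℂ)) * (2 * (2 * Real.pi * a)))) * Complex.exp (((2 * Real.pi * a : ℝ) : ℂ) * (1 / 4 : ℝ)))) (-(2 * Real.pi * a)) (-(1 / 4 : ℝ)) (1 / 4 : ℝ)).intervalIntegrable (μ := volume) _ _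
  · exact (hc (-(Real.pi * a)) (((starRingEnd ℂ (Complex.exp (2 * Real.pi * β * Complex.I))) * (-1 / ((1 - starRingEnd ℂ (Complex.exp (2 * Real.pi * β * Complex.I)) * (Real.exp (-(2 * Real.pi * a)) : ℂ)) * (2 * (2 * Real.pi * a)))) * Complex.exp (-((2 * Real.pi * a : ℝ) : ℂ) * (5 / 4 : ℝ)))) (((starRingEnd ℂ (Complex.exp (2 * Real.pi * β * Complex.I))) * (-(Complex.exp (2 * Real.pi * β * Complex.I) * (Real.exp (-(2 * Real.pi * a)) : ℂ)) / ((1 - Complex.exp (2 * Real.pi * β * Complex.I) * (Real.exp (-(2 * Real.pi * a)) : ℂ)) * (2 * (2 * Real.pi * a)))) * Complex.exp (((2 * Real.pi * a : ℝ) : ℂ) * (5 / 4 : ℝ)))) (2 * Real.pi * a) (1 / 4 : ℝ) (1 / 2 : ℝ)).intervalIntegrable (μ := volume) _ _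
  · exact add_le_add (add_le_add
      (norm_integral_cos_piece_le (ω := ω) hθ (((1 : ℂ) * (-1 / ((1 - starRingEnd ℂ (Complex.exp (2 * Real.pi * β * Complex.I)) * (Real.exp (-(2 * Real.pi * a)) : ℂ)) * (2 * (2 * Real.pi * a)))) * Complex.exp (-((2 * Real.pi * a : ℝ) : ℂ) * (1 / 4 : ℝ)))) (((1 : ℂ) * (-(Complex.exp (2 * Real.pi * β * Complex.I) * (Real.exp (-(2 * Real.pi * a)) : ℂ)) / ((1 - Complex.exp (2 * Real.pi * β * Complex.I) * (Real.exp (-(2 * Real.pi * a)) : ℂ)) * (2 * (2 * Real.pi * a)))) * Complex.exp (((2 * Real.pi * a : ℝ) : ℂ) * (1 / 4 : ℝ)))) hμ1 hμ2 (2 * Real.pi * ξ) (2 * Real.pi * a) (Real.pi * a) (-(1 / 2 : ℝ)) (-(1 / 4 : ℝ)) (by intro h; apply hω; linarith) (by intro h; apply hω; linarith) (by intro h; apply hω1; linarith) (by intro h; apply hω2; linarith))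
      (norm_integral_cos_piece_le (ω := ω) hθ (((1 : ℂ) * (-1 / ((1 - starRingEnd ℂ (Complex.exp (2 * Real.pi * β * Complex.I)) * (Real.exp (-(2 * Real.pi * a)) : ℂ)) * (2 * (2 * Real.pi * a)))) * Complex.exp (-((2 * Real.pi * a : ℝ) : ℂ) * (1 / 4 : ℝ)))) (((1 : ℂ) * (-(Complex.exp (2 * Real.pi * β * Complex.I) * (Real.exp (-(2 * Real.pi * a)) : ℂ)) / ((1 - Complex.exp (2 * Real.pi * β * Complex.I) * (Real.exp (-(2 * Real.pi * a)) : ℂ)) * (2 * (2 * Real.pi * a)))) * Complex.exp (((2 * Real.pi * a : ℝ) : ℂ) * (1 / 4 : ℝ)))) hμ1 hμ2 (2 * Real.pi * ξ) (-(2 * Real.pi * a)) (0 : ℝ) (-(1 / 4 : ℝ)) (1 / 4 : ℝ) (by intro h; apply hω1; linarith) (by intro h; apply hω2; linarith) (by intro h; apply hω2; linarith) (by intro h; apply hω1; linarith)))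
      (norm_integral_cos_piece_le (ω := ω) hθ (((starRingEnd ℂ (Complex.exp (2 * Real.pi * β * Complex.I))) * (-1 / ((1 - starRingEnd ℂ (Complex.exp (2 * Real.pi * β * Complex.I)) * (Real.exp (-(2 * Real.pi * a)) : ℂ)) * (2 * (2 * Real.pi * a)))) * Complex.exp (-((2 * Real.pi * a : ℝ) : ℂ) * (5 / 4 : ℝ)))) (((starRingEnd ℂ (Complex.exp (2 * Real.pi * β * Complex.I))) * (-(Complex.exp (2 * Real.pi * β * Complex.I) * (Real.exp (-(2 * Real.pi * a)) : ℂ)) / ((1 - Complex.exp (2 * Real.pi * β * Complex.I) * (Real.exp (-(2 * Real.pi * a)) : ℂ)) * (2 * (2 * Real.pi * a)))) * Complex.exp (((2 * Real.pi * a : ℝ) : ℂ) * (5 / 4 : ℝ)))) hμ1 hμ2 (2 * Real.pi * ξ) (2 * Real.pi * a) (-(Real.pi * a)) (1 / 4 : ℝ) (1 / 2 : ℝ) (by intro h; apply hω2; linarith) (by intro h; apply hω1; linarith) (by intro h; apply hω; linarith) (by intro h; apply hω; linarith))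


/-- **Response of the `sin` propagator entry to the single-mode source at `y₀ = ¼`** (`a > 0`, `θ ≥ 0`, `ω ∉ {0, ±πa/2}`): the twelve-term bound,
uniform in `θ` and `ξ`. [cite: Drazin2002, §8.3 (8.36)–(8.38)] -/
theorem norm_integral_sin_src_quarter_le (ha : 0 < a) (β ξ : ℝ) {ω θ : ℝ} (hθ : 0 ≤ θ) (hω : ω ≠ 0)
    (hω1 : Real.pi * a / 2 - ω ≠ 0) (hω2 : Real.pi * a / 2 + ω ≠ 0)
    (hK : K = fun r : ℝ => (-((Real.exp (-(2 * Real.pi * a * r)) : ℂ) /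
            (1 - starRingEnd ℂ (Complex.exp (2 * Real.pi * β * Complex.I)) * (Real.exp (-(2 * Real.pi * a)) : ℂ))
          + (Real.exp (2 * Real.pi * a * (r - 1)) : ℂ) * Complex.exp (2 * Real.pi * β * Complex.I) /
            (1 - Complex.exp (2 * Real.pi * β * Complex.I) * (Real.exp (-(2 * Real.pi * a)) : ℂ))) /
        (2 * (2 * Real.pi * a) : ℂ)))
    (hG : ∀ u : ℝ, G u = Complex.exp (2 * Real.pi * β * (⌊u⌋ : ℝ) * Complex.I) * K (u - ⌊u⌋)) :
    ‖∫ s in (0 : ℝ)..θ, ((Real.sin (ω * (θ - s)) / ω : ℝ) : ℂ) *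
        ∫ y in (-(1 / 2 : ℝ))..(1 / 2 : ℝ), G ((1 / 4 : ℝ) - y) * Complex.exp (((2 * Real.pi * ξ * y : ℝ) : ℂ) * Complex.I) * Complex.exp (-((2 * Real.pi * a * s * triWave y : ℝ) : ℂ) * Complex.I)‖ ≤
      ((‖((1 : ℂ) * (-1 / ((1 - starRingEnd ℂ (Complex.exp (2 * Real.pi * β * Complex.I)) * (Real.exp (-(2 * Real.pi * a)) : ℂ)) * (2 * (2 * Real.pi * a)))) * Complex.exp (-((2 * Real.pi * a : ℝ) : ℂ) * (1 / 4 : ℝ)))‖ * Real.exp ((2 * Real.pi * a) * (-(1 / 4 : ℝ))) * (2 + Real.pi) / |(2 * Real.pi * a)| * (1 / |(Real.pi * a) + (2 * Real.pi * a) * (-(1 / 4 : ℝ)) - ω| + 1 / |(Real.pi * a) + (2 * Real.pi * a) * (-(1 / 4 : ℝ)) + ω|) * (1 / (2 * |ω|)) +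
        ‖((1 : ℂ) * (-1 / ((1 - starRingEnd ℂ (Complex.exp (2 * Real.pi * β * Complex.I)) * (Real.exp (-(2 * Real.pi * a)) : ℂ)) * (2 * (2 * Real.pi * a)))) * Complex.exp (-((2 * Real.pi * a : ℝ) : ℂ) * (1 / 4 : ℝ)))‖ * Real.exp ((2 * Real.pi * a) * (-(1 / 2 : ℝ))) * (2 + Real.pi) / |(2 * Real.pi * a)| * (1 / |(Real.pi * a) + (2 * Real.pi * a) * (-(1 / 2 : ℝ)) - ω| + 1 / |(Real.pi * a) + (2 * Real.pi * a) * (-(1 / 2 : ℝ)) + ω|) * (1 / (2 * |ω|))) +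
      (‖((1 : ℂ) * (-(Complex.exp (2 * Real.pi * β * Complex.I) * (Real.exp (-(2 * Real.pi * a)) : ℂ)) / ((1 - Complex.exp (2 * Real.pi * β * Complex.I) * (Real.exp (-(2 * Real.pi * a)) : ℂ)) * (2 * (2 * Real.pi * a)))) * Complex.exp (((2 * Real.pi * a : ℝ) : ℂ) * (1 / 4 : ℝ)))‖ * Real.exp ((-(2 * Real.pi * a)) * (-(1 / 4 : ℝ))) * (2 + Real.pi) / |(-(2 * Real.pi * a))| * (1 / |(Real.pi * a) + (2 * Real.pi * a) * (-(1 / 4 : ℝ)) - ω| + 1 / |(Real.pi * a) + (2 * Real.pi * a) * (-(1 / 4 : ℝ)) + ω|) * (1 / (2 * |ω|)) +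
        ‖((1 : ℂ) * (-(Complex.exp (2 * Real.pi * β * Complex.I) * (Real.exp (-(2 * Real.pi * a)) : ℂ)) / ((1 - Complex.exp (2 * Real.pi * β * Complex.I) * (Real.exp (-(2 * Real.pi * a)) : ℂ)) * (2 * (2 * Real.pi * a)))) * Complex.exp (((2 * Real.pi * a : ℝ) : ℂ) * (1 / 4 : ℝ)))‖ * Real.exp ((-(2 * Real.pi * a)) * (-(1 / 2 : ℝ))) * (2 + Real.pi) / |(-(2 * Real.pi * a))| * (1 / |(Real.pi * a) + (2 * Real.pi * a) * (-(1 / 2 : ℝ)) - ω| + 1 / |(Real.pi * a) + (2 * Real.pi * a) * (-(1 / 2 : ℝ)) + ω|) * (1 / (2 * |ω|)))) +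
      ((‖((1 : ℂ) * (-1 / ((1 - starRingEnd ℂ (Complex.exp (2 * Real.pi * β * Complex.I)) * (Real.exp (-(2 * Real.pi * a)) : ℂ)) * (2 * (2 * Real.pi * a)))) * Complex.exp (-((2 * Real.pi * a : ℝ) : ℂ) * (1 / 4 : ℝ)))‖ * Real.exp ((2 * Real.pi * a) * (1 / 4 : ℝ)) * (2 + Real.pi) / |(2 * Real.pi * a)| * (1 / |(0 : ℝ) + (-(2 * Real.pi * a)) * (1 / 4 : ℝ) - ω| + 1 / |(0 : ℝ) + (-(2 * Real.pi * a)) * (1 / 4 : ℝ) + ω|) * (1 / (2 * |ω|)) +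
        ‖((1 : ℂ) * (-1 / ((1 - starRingEnd ℂ (Complex.exp (2 * Real.pi * β * Complex.I)) * (Real.exp (-(2 * Real.pi * a)) : ℂ)) * (2 * (2 * Real.pi * a)))) * Complex.exp (-((2 * Real.pi * a : ℝ) : ℂ) * (1 / 4 : ℝ)))‖ * Real.exp ((2 * Real.pi * a) * (-(1 / 4 : ℝ))) * (2 + Real.pi) / |(2 * Real.pi * a)| * (1 / |(0 : ℝ) + (-(2 * Real.pi * a)) * (-(1 / 4 : ℝ)) - ω| + 1 / |(0 : ℝ) + (-(2 * Real.pi * a)) * (-(1 / 4 : ℝ)) + ω|) * (1 / (2 * |ω|))) +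
      (‖((1 : ℂ) * (-(Complex.exp (2 * Real.pi * β * Complex.I) * (Real.exp (-(2 * Real.pi * a)) : ℂ)) / ((1 - Complex.exp (2 * Real.pi * β * Complex.I) * (Real.exp (-(2 * Real.pi * a)) : ℂ)) * (2 * (2 * Real.pi * a)))) * Complex.exp (((2 * Real.pi * a : ℝ) : ℂ) * (1 / 4 : ℝ)))‖ * Real.exp ((-(2 * Real.pi * a)) * (1 / 4 : ℝ)) * (2 + Real.pi) / |(-(2 * Real.pi * a))| * (1 / |(0 : ℝ) + (-(2 * Real.pi * a)) * (1 / 4 : ℝ) - ω| + 1 / |(0 : ℝ) + (-(2 * Real.pi * a)) * (1 / 4 : ℝ) + ω|) * (1 / (2 * |ω|)) +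
        ‖((1 : ℂ) * (-(Complex.exp (2 * Real.pi * β * Complex.I) * (Real.exp (-(2 * Real.pi * a)) : ℂ)) / ((1 - Complex.exp (2 * Real.pi * β * Complex.I) * (Real.exp (-(2 * Real.pi * a)) : ℂ)) * (2 * (2 * Real.pi * a)))) * Complex.exp (((2 * Real.pi * a : ℝ) : ℂ) * (1 / 4 : ℝ)))‖ * Real.exp ((-(2 * Real.pi * a)) * (-(1 / 4 : ℝ))) * (2 + Real.pi) / |(-(2 * Real.pi * a))| * (1 / |(0 : ℝ) + (-(2 * Real.pi * a)) * (-(1 / 4 : ℝ)) - ω| + 1 / |(0 : ℝ) + (-(2 * Real.pi * a)) * (-(1 / 4 : ℝ)) + ω|) * (1 / (2 * |ω|)))) +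
      ((‖((starRingEnd ℂ (Complex.exp (2 * Real.pi * β * Complex.I))) * (-1 / ((1 - starRingEnd ℂ (Complex.exp (2 * Real.pi * β * Complex.I)) * (Real.exp (-(2 * Real.pi * a)) : ℂ)) * (2 * (2 * Real.pi * a)))) * Complex.exp (-((2 * Real.pi * a : ℝ) : ℂ) * (5 / 4 : ℝ)))‖ * Real.exp ((2 * Real.pi * a) * (1 / 2 : ℝ)) * (2 + Real.pi) / |(2 * Real.pi * a)| * (1 / |(-(Real.pi * a)) + (2 * Real.pi * a) * (1 / 2 : ℝ) - ω| + 1 / |(-(Real.pi * a)) + (2 * Real.pi * a) * (1 / 2 : ℝ) + ω|) * (1 / (2 * |ω|)) +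
        ‖((starRingEnd ℂ (Complex.exp (2 * Real.pi * β * Complex.I))) * (-1 / ((1 - starRingEnd ℂ (Complex.exp (2 * Real.pi * β * Complex.I)) * (Real.exp (-(2 * Real.pi * a)) : ℂ)) * (2 * (2 * Real.pi * a)))) * Complex.exp (-((2 * Real.pi * a : ℝ) : ℂ) * (5 / 4 : ℝ)))‖ * Real.exp ((2 * Real.pi * a) * (1 / 4 : ℝ)) * (2 + Real.pi) / |(2 * Real.pi * a)| * (1 / |(-(Real.pi * a)) + (2 * Real.pi * a) * (1 / 4 : ℝ) - ω| + 1 / |(-(Real.pi * a)) + (2 * Real.pi * a) * (1 / 4 : ℝ) + ω|) * (1 / (2 * |ω|))) +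
      (‖((starRingEnd ℂ (Complex.exp (2 * Real.pi * β * Complex.I))) * (-(Complex.exp (2 * Real.pi * β * Complex.I) * (Real.exp (-(2 * Real.pi * a)) : ℂ)) / ((1 - Complex.exp (2 * Real.pi * β * Complex.I) * (Real.exp (-(2 * Real.pi * a)) : ℂ)) * (2 * (2 * Real.pi * a)))) * Complex.exp (((2 * Real.pi * a : ℝ) : ℂ) * (5 / 4 : ℝ)))‖ * Real.exp ((-(2 * Real.pi * a)) * (1 / 2 : ℝ)) * (2 + Real.pi) / |(-(2 * Real.pi * a))| * (1 / |(-(Real.pi * a)) + (2 * Real.pi * a) * (1 / 2 : ℝ) - ω| + 1 / |(-(Real.pi * a)) + (2 * Real.pi * a) * (1 / 2 : ℝ) + ω|) * (1 / (2 * |ω|)) +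
        ‖((starRingEnd ℂ (Complex.exp (2 * Real.pi * β * Complex.I))) * (-(Complex.exp (2 * Real.pi * β * Complex.I) * (Real.exp (-(2 * Real.pi * a)) : ℂ)) / ((1 - Complex.exp (2 * Real.pi * β * Complex.I) * (Real.exp (-(2 * Real.pi * a)) : ℂ)) * (2 * (2 * Real.pi * a)))) * Complex.exp (((2 * Real.pi * a : ℝ) : ℂ) * (5 / 4 : ℝ)))‖ * Real.exp ((-(2 * Real.pi * a)) * (1 / 4 : ℝ)) * (2 + Real.pi) / |(-(2 * Real.pi * a))| * (1 / |(-(Real.pi * a)) + (2 * Real.pi * a) * (1 / 4 : ℝ) - ω| + 1 / |(-(Real.pi * a)) + (2 * Real.pi * a) * (1 / 4 : ℝ) + ω|) * (1 / (2 * |ω|)))) := by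
  have hμ1 : (2 * Real.pi * a : ℝ) ≠ 0 := by positivity
  have hμ2 : (-(2 * Real.pi * a) : ℝ) ≠ 0 := by
    have : (0:ℝ) < 2 * Real.pi * a := by positivity
    linarith
  simp_rw [src_quarter_pieces ha β ξ hK hG]
  have hc : ∀ (φ₀ : ℝ) (c₁ c₂ : ℂ) (ν y₁ y₂ : ℝ), Continuous fun s : ℝ => ((Real.sin (ω * (θ - s)) / ω : ℝ) : ℂ) *
      (Complex.exp (((φ₀ * s : ℝ)) * Complex.I) *
        (c₁ * ((Complex.exp ((((((2 * Real.pi * a) : ℝ)) : ℂ) + ((((2 * Real.pi * ξ) + ν * s : ℝ)) : ℂ) * Complex.I) * y₂) - Complex.exp ((((((2 * Real.pi * a) : ℝ)) : ℂ) + ((((2 * Real.pi * ξ) + ν * s : ℝ)) : ℂ) * Complex.I) * y₁)) / (((((2 * Real.pi * a) : ℝ)) : ℂ) + ((((2 * Real.pi * ξ) + ν * s : ℝ)) : ℂ) * Complex.I)) +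
         c₂ * ((Complex.exp ((((((-(2 * Real.pi * a)) : ℝ)) : ℂ) + ((((2 * Real.pi * ξ) + ν * s : ℝ)) : ℂ) * Complex.I) * y₂) - Complex.exp ((((((-(2 * Real.pi * a)) : ℝ)) : ℂ) + ((((2 * Real.pi * ξ) + ν * s : ℝ)) : ℂ) * Complex.I) * y₁)) / (((((-(2 * Real.pi * a)) : ℝ)) : ℂ) + ((((2 * Real.pi * ξ) + ν * s : ℝ)) : ℂ) * Complex.I)))) := by
    intro φ₀ c₁ c₂ ν y₁ y₂
    have d1 : ∀ s : ℝ, ((((2 * Real.pi * a) : ℝ)) : ℂ) + ((((2 * Real.pi * ξ) + ν * s : ℝ)) : ℂ) * Complex.I ≠ 0 := fun s => lorentz_denom_ne_zero hμ1 _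
    have d2 : ∀ s : ℝ, ((((-(2 * Real.pi * a)) : ℝ)) : ℂ) + ((((2 * Real.pi * ξ) + ν * s : ℝ)) : ℂ) * Complex.I ≠ 0 := fun s => lorentz_denom_ne_zero hμ2 _
    refine Continuous.mul (by fun_prop) (Continuous.mul (by fun_prop) (Continuous.add ?_ ?_))
    · exact continuous_const.mul (Continuous.div (by fun_prop) (by fun_prop) d1)
    · exact continuous_const.mul (Continuous.div (by fun_prop) (by fun_prop) d2)
  refine (norm_integral_three_le ?_ ?_ ?_).trans ?_
  · exact (hc (Real.pi * a) (((1 : ℂ) * (-1 / ((1 - starRingEnd ℂ (Complex.exp (2 * Real.pi * β * Complex.I)) * (Real.exp (-(2 * Real.pi * a)) : ℂ)) * (2 * (2 * Real.pi * a)))) * Complex.exp (-((2 * Real.pi * a : ℝ) : ℂ) * (1 / 4 : ℝ)))) (((1 : ℂ) * (-(Complex.exp (2 * Real.pi * β * Complex.I) * (Real.exp (-(2 * Real.pi * a)) : ℂ)) / ((1 - Complex.exp (2 * Real.pi * β * Complex.I) * (Real.exp (-(2 * Real.pi * a)) : ℂ)) * (2 * (2 * Real.pi * a)))) * Complex.exp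 (((2 * Real.pi * a : ℝ) : ℂ) * (1 / 4 : ℝ)))) (2 * Real.pi * a) (-(1 / 2 : ℝ)) (-(1 / 4 : ℝ))).intervalIntegrable (μ := volume) _ _
  · exact (hc (0 : ℝ) (((1 : ℂ) * (-1 / ((1 - starRingEnd ℂ (Complex.exp (2 * Real.pi * β * Complex.I)) * (Real.exp (-(2 * Real.pi * a)) : ℂ)) * (2 * (2 * Real.pi * a)))) * Complex.exp (-((2 * Real.pi * a : ℝ) : ℂ) * (1 / 4 : ℝ)))) (((1 : ℂ) * (-(Complex.exp (2 * Real.pi * β * Complex.I) * (Real.exp (-(2 * Real.pi * a)) : ℂ)) / ((1 - Complex.exp (2 * Real.pi * β * Complex.I) * (Real.exp (-(2 * Real.pi * a)) : ℂ)) * (2 * (2 * Real.pi * a)))) * Complex.exp (((2 * Real.pi * a : ℝ) : ℂ) * (1 / 4 : ℝ)))) (-(2 * Real.pi * a)) (-(1 / 4 : ℝ)) (1 / 4 : ℝ)).intervalIntegrable (μ := volume) _ _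
  · exact (hc (-(Real.pi * a)) (((starRingEnd ℂ (Complex.exp (2 * Real.pi * β * Complex.I))) * (-1 / ((1 - starRingEnd ℂ (Complex.exp (2 * Real.pi * β * Complex.I)) * (Real.exp (-(2 * Real.pi * a)) : ℂ)) * (2 * (2 * Real.pi * a)))) * Complex.exp (-((2 * Real.pi * a : ℝ) : ℂ) * (5 / 4 : ℝ)))) (((starRingEnd ℂ (Complex.exp (2 * Real.pi * β * Complex.I))) * (-(Complex.exp (2 * Real.pi * β * Complex.I) * (Real.exp (-(2 * Real.pi * a)) : ℂ)) / ((1 - Complex.exp (2 * Real.pi * β * Complex.I) * (Real.exp (-(2 * Real.pi * a)) : ℂ)) * (2 * (2 * Real.pi * a)))) * Complex.exp (((2 * Real.pi * a : ℝ) : ℂ) * (5 / 4 : ℝ)))) (2 * Real.pi * a) (1 / 4 : ℝ) (1 / 2 : ℝ)).intervalIntegrable (μ := volume) _ _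
  · exact add_le_add (add_le_add
      (norm_integral_sin_piece_le hω hθ (((1 : ℂ) * (-1 / ((1 - starRingEnd ℂ (Complex.exp (2 * Real.pi * β * Complex.I)) * (Real.exp (-(2 * Real.pi * a)) : ℂ)) * (2 * (2 * Real.pi * a)))) * Complex.exp (-((2 * Real.pi * a : ℝ) : ℂ) * (1 / 4 : ℝ)))) (((1 : ℂ) * (-(Complex.exp (2 * Real.pi * β * Complex.I) * (Real.exp (-(2 * Real.pi * a)) : ℂ)) / ((1 - Complex.exp (2 * Real.pi * β * Complex.I) * (Real.exp (-(2 * Real.pi * a)) : ℂ)) * (2 * (2 * Real.pi * a)))) * Complex.exp (((2 * Real.pi * a : ℝ) : ℂ) * (1 / 4 : ℝ)))) hμ1 hμ2 (2 * Real.pi * ξ) (2 * Real.pi * a) (Real.pi * a) (-(1 / 2 : ℝ)) (-(1 / 4 : ℝ)) (by intro h; apply hω; linarith) (by intro h; apply hω; linarith) (by intro h; apply hω1; linarith) (by intro h; apply hω2; linarith))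
      (norm_integral_sin_piece_le hω hθ (((1 : ℂ) * (-1 / ((1 - starRingEnd ℂ (Complex.exp (2 * Real.pi * β * Complex.I)) * (Real.exp (-(2 * Real.pi * a)) : ℂ)) * (2 * (2 * Real.pi * a)))) * Complex.exp (-((2 * Real.pi * a : ℝ) : ℂ) * (1 / 4 : ℝ)))) (((1 : ℂ) * (-(Complex.exp (2 * Real.pi * β * Complex.I) * (Real.exp (-(2 * Real.pi * a)) : ℂ)) / ((1 - Complex.exp (2 * Real.pi * β * Complex.I) * (Real.exp (-(2 * Real.pi * a)) : ℂ)) * (2 * (2 * Real.pi * a)))) * Complex.exp (((2 * Real.pi * a : ℝ) : ℂ) * (1 / 4 : ℝ)))) hμ1 hμ2 (2 * Real.pi * ξ) (-(2 * Real.pi * a)) (0 : ℝ) (-(1 / 4 : ℝ)) (1 / 4 : ℝ) (by intro h; apply hω1; linarith) (by intro h; apply hω2; linarith) (by intro h; apply hω2; linarith) (by intro h; apply hω1; linarith)))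
      (norm_integral_sin_piece_le hω hθ (((starRingEnd ℂ (Complex.exp (2 * Real.pi * β * Complex.I))) * (-1 / ((1 - starRingEnd ℂ (Complex.exp (2 * Real.pi * β * Complex.I)) * (Real.exp (-(2 * Real.pi * a)) : ℂ)) * (2 * (2 * Real.pi * a)))) * Complex.exp (-((2 * Real.pi * a : ℝ) : ℂ) * (5 / 4 : ℝ)))) (((starRingEnd ℂ (Complex.exp (2 * Real.pi * β * Complex.I))) * (-(Complex.exp (2 * Real.pi * β * Complex.I) * (Real.exp (-(2 * Real.pi * a)) : ℂ)) / ((1 - Complex.exp (2 * Real.pi * β * Complex.I) * (Real.exp (-(2 * Real.pi * a)) : ℂ)) * (2 * (2 * Real.pi * a)))) * Complex.exp (((2 * Real.pi * a : ℝ) : ℂ) * (5 / 4 : ℝ)))) hμ1 hμ2 (2 * Real.pi * ξ) (2 * Real.pi * a) (-(Real.pi * a)) (1 / 4 : ℝ) (1 / 2 : ℝ) (by intro h; apply hω2; linarith) (by intro h; apply hω1; linarith) (by intro h; apply hω; linarith) (by intro h; apply hω; linarith))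


/-- The closed form of the source at `y₀ = −¼` as three PIECES in Lorentzian-ready shape (`μ = ±2πa`, `ν₀ = 2πξ`, `ν = ±2πa`,
phases `φ₀ = πa, 0, −πa`). [cite: Drazin2002, §8.3 (8.36)–(8.38)] -/
theorem src_negQuarter_pieces (ha : 0 < a) (β ξ : ℝ)
    (hK : K = fun r : ℝ => (-((Real.exp (-(2 * Real.pi * a * r)) : ℂ) /
            (1 - starRingEnd ℂ (Complex.exp (2 * Real.pi * β * Complex.I)) * (Real.exp (-(2 * Real.pi * a)) : ℂ))
          + (Real.exp (2 * Real.pi * a * (r - 1)) : ℂ) * Complex.exp (2 * Real.pi * β * Complex.I) /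
            (1 - Complex.exp (2 * Real.pi * β * Complex.I) * (Real.exp (-(2 * Real.pi * a)) : ℂ))) /
        (2 * (2 * Real.pi * a) : ℂ)))
    (hG : ∀ u : ℝ, G u = Complex.exp (2 * Real.pi * β * (⌊u⌋ : ℝ) * Complex.I) * K (u - ⌊u⌋)) (s : ℝ) :
    ∫ y in (-(1 / 2 : ℝ))..(1 / 2 : ℝ), G ((-(1 / 4 : ℝ)) - y) * Complex.exp (((2 * Real.pi * ξ * y : ℝ) : ℂ) * Complex.I) * Complex.exp (-((2 * Real.pi * a * s * triWave y : ℝ) : ℂ) * Complex.I) =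
      (Complex.exp ((((Real.pi * a) * s : ℝ)) * Complex.I) *
          (((1 : ℂ) * (-1 / ((1 - starRingEnd ℂ (Complex.exp (2 * Real.pi * β * Complex.I)) * (Real.exp (-(2 * Real.pi * a)) : ℂ)) * (2 * (2 * Real.pi * a)))) * Complex.exp (-((2 * Real.pi * a : ℝ) : ℂ) * (-(1 / 4 : ℝ)))) * ((Complex.exp ((((((2 * Real.pi * a) : ℝ)) : ℂ) + ((((2 * Real.pi * ξ) + (2 * Real.pi * a) * s : ℝ)) : ℂ) * Complex.I) * (((-(1 / 4 : ℝ)) : ℝ) : ℂ)) - Complex.exp ((((((2 * Real.pi * a) : ℝ)) : ℂ) + ((((2 * Real.pi * ξ) + (2 * Real.pi * a) * s : ℝ)) : ℂ) * Complex.I) * (((-(1 / 2 : ℝ)) : ℝ) : ℂ))) / (((((2 * Real.pi * a) : ℝ)) : ℂ) + ((((2 * Real.pi * ξ) + (2 * Real.pi * a) * s : ℝ)) : ℂ) * Complex.I)) +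
           ((1 : ℂ) * (-(Complex.exp (2 * Real.pi * β * Complex.I) * (Real.exp (-(2 * Real.pi * a)) : ℂ)) / ((1 - Complex.exp (2 * Real.pi * β * Complex.I) * (Real.exp (-(2 * Real.pi * a)) : ℂ)) * (2 * (2 * Real.pi * a)))) * Complex.exp (((2 * Real.pi * a : ℝ) : ℂ) * (-(1 / 4 : ℝ)))) * ((Complex.exp ((((((-(2 * Real.pi * a)) : ℝ)) : ℂ) + ((((2 * Real.pi * ξ) + (2 * Real.pi * a) * s : ℝ)) : ℂ) * Complex.I) * (((-(1 / 4 : ℝ)) : ℝ) : ℂ)) - Complex.exp ((((((-(2 * Real.pi * a)) : ℝ)) : ℂ) + ((((2 * Real.pi * ξ) + (2 * Real.pi * a) * s : ℝ)) : ℂ) * Complex.I) * (((-(1 / 2 : ℝ)) : ℝ) : ℂ))) / (((((-(2 * Real.pi * a)) : ℝ)) : ℂ) + ((((2 * Real.pi * ξ) + (2 * Real.pi * a) * s : ℝ)) : ℂ) * Complex.I)))) +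
        (Complex.exp ((((0 : ℝ) * s : ℝ)) * Complex.I) *
          (((starRingEnd ℂ (Complex.exp (2 * Real.pi * β * Complex.I))) * (-1 / ((1 - starRingEnd ℂ (Complex.exp (2 * Real.pi * β * Complex.I)) * (Real.exp (-(2 * Real.pi * a)) : ℂ)) * (2 * (2 * Real.pi * a)))) * Complex.exp (-((2 * Real.pi * a : ℝ) : ℂ) * (3 / 4 : ℝ))) * ((Complex.exp ((((((2 * Real.pi * a) : ℝ)) : ℂ) + ((((2 * Real.pi * ξ) + (-(2 * Real.pi * a)) * s : ℝ)) : ℂ) * Complex.I) * (((1 / 4 : ℝ) : ℝ) : ℂ)) - Complex.exp ((((((2 * Real.pi * a) : ℝ)) : ℂ) + ((((2 * Real.pi * ξ) + (-(2 * Real.pi * a)) * s : ℝ)) : ℂ) * Complex.I) * (((-(1 / 4 : ℝ)) : ℝ) : ℂ))) / (((((2 * Real.pi * a) : ℝ)) : ℂ) + ((((2 * Real.pi * ξ) + (-(2 * Real.pi * a)) * s : ℝ)) : ℂ) * Complex.I)) +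
           ((starRingEnd ℂ (Complex.exp (2 * Real.pi * β * Complex.I))) * (-(Complex.exp (2 * Real.pi * β * Complex.I) * (Real.exp (-(2 * Real.pi * a)) : ℂ)) / ((1 - Complex.exp (2 * Real.pi * β * Complex.I) * (Real.exp (-(2 * Real.pi * a)) : ℂ)) * (2 * (2 * Real.pi * a)))) * Complex.exp (((2 * Real.pi * a : ℝ) : ℂ) * (3 / 4 : ℝ))) * ((Complex.exp ((((((-(2 * Real.pi * a)) : ℝ)) : ℂ) + ((((2 * Real.pi * ξ) + (-(2 * Real.pi * a)) * s : ℝ)) : ℂ) * Complex.I) * (((1 / 4 : ℝ) : ℝ) : ℂ)) - Complex.exp ((((((-(2 * Real.pi * a)) : ℝ)) : ℂ) + ((((2 * Real.pi * ξ) + (-(2 * Real.pi * a)) * s : ℝ)) : ℂ) * Complex.I) * (((-(1 / 4 : ℝ)) : ℝ) : ℂ))) / (((((-(2 * Real.pi * a)) : ℝ)) : ℂ) + ((((2 * Real.pi * ξ) + (-(2 * Real.pi * a)) * s : ℝ)) : ℂ) * Complex.I)))) +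
        (Complex.exp ((((-(Real.pi * a)) * s : ℝ)) * Complex.I) *
          (((starRingEnd ℂ (Complex.exp (2 * Real.pi * β * Complex.I))) * (-1 / ((1 - starRingEnd ℂ (Complex.exp (2 * Real.pi * β * Complex.I)) * (Real.exp (-(2 * Real.pi * a)) : ℂ)) * (2 * (2 * Real.pi * a)))) * Complex.exp (-((2 * Real.pi * a : ℝ) : ℂ) * (3 / 4 : ℝ))) * ((Complex.exp ((((((2 * Real.pi * a) : ℝ)) : ℂ) + ((((2 * Real.pi * ξ) + (2 * Real.pi * a) * s : ℝ)) : ℂ) * Complex.I) * (((1 / 2 : ℝ) : ℝ) : ℂ)) - Complex.exp ((((((2 * Real.pi * a) : ℝ)) : ℂ) + ((((2 * Real.pi * ξ) + (2 * Real.pi * a) * s : ℝ)) : ℂ) * Complex.I) * (((1 / 4 : ℝ) : ℝ) : ℂ))) / (((((2 * Real.pi * a) : ℝ)) : ℂ) + ((((2 * Real.pi * ξ) + (2 * Real.pi * a) * s : ℝ)) : ℂ) * Complex.I)) +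
           ((starRingEnd ℂ (Complex.exp (2 * Real.pi * β * Complex.I))) * (-(Complex.exp (2 * Real.pi * β * Complex.I) * (Real.exp (-(2 * Real.pi * a)) : ℂ)) / ((1 - Complex.exp (2 * Real.pi * β * Complex.I) * (Real.exp (-(2 * Real.pi * a)) : ℂ)) * (2 * (2 * Real.pi * a)))) * Complex.exp (((2 * Real.pi * a : ℝ) : ℂ) * (3 / 4 : ℝ))) * ((Complex.exp ((((((-(2 * Real.pi * a)) : ℝ)) : ℂ) + ((((2 * Real.pi * ξ) + (2 * Real.pi * a) * s : ℝ)) : ℂ) * Complex.I) * (((1 / 2 : ℝ) : ℝ) : ℂ)) - Complex.exp ((((((-(2 * Real.pi * a)) : ℝ)) : ℂ) + ((((2 * Real.pi * ξ) + (2 * Real.pi * a) * s : ℝ)) : ℂ) * Complex.I) * (((1 / 4 : ℝ) : ℝ) : ℂ))) / (((((-(2 * Real.pi * a)) : ℝ)) : ℂ) + ((((2 * Real.pi * ξ) + (2 * Real.pi * a) * s : ℝ)) : ℂ) * Complex.I)))) := by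
  rw [forcing_src_negQuarter ha β ξ s hK hG, show Complex.exp ((((0 : ℝ) * s : ℝ)) * Complex.I) = (1 : ℂ) by simp]
  have e1 : ((2 * Real.pi * (ξ + a * s) : ℝ) : ℂ) = (((2 * Real.pi * ξ) + (2 * Real.pi * a) * s : ℝ) : ℂ) := by push_cast; ring
  have e2 : ((2 * Real.pi * (ξ - a * s) : ℝ) : ℂ) = (((2 * Real.pi * ξ) + (-(2 * Real.pi * a)) * s : ℝ) : ℂ) := by push_cast; ring
  have e3 : -((2 * Real.pi * a : ℝ) : ℂ) = (((-(2 * Real.pi * a)) : ℝ) : ℂ) := by push_cast; ring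
  have e5 : Complex.exp (-((Real.pi * a * s : ℝ) : ℂ) * Complex.I) = Complex.exp ((((-(Real.pi * a)) * s : ℝ)) * Complex.I) := by
    congr 1; push_cast; ring
  rw [e1, e2, e3, e5]
  push_cast
  ring_nf


/-- **Response of the `cos` propagator entry to the single-mode source at `y₀ = −¼`** (`a > 0`, `θ ≥ 0`, `ω ∉ {0, ±πa/2}`): the twelve-term bound,
uniform in `θ` and `ξ`. [cite: Drazin2002, §8.3 (8.36)–(8.38)] -/
theorem norm_integral_cos_src_negQuarter_le (ha : 0 < a) (β ξ : ℝ) {ω θ : ℝ} (hθ : 0 ≤ θ) (hω : ω ≠ 0)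
    (hω1 : Real.pi * a / 2 - ω ≠ 0) (hω2 : Real.pi * a / 2 + ω ≠ 0)
    (hK : K = fun r : ℝ => (-((Real.exp (-(2 * Real.pi * a * r)) : ℂ) /
            (1 - starRingEnd ℂ (Complex.exp (2 * Real.pi * β * Complex.I)) * (Real.exp (-(2 * Real.pi * a)) : ℂ))
          + (Real.exp (2 * Real.pi * a * (r - 1)) : ℂ) * Complex.exp (2 * Real.pi * β * Complex.I) /
            (1 - Complex.exp (2 * Real.pi * β * Complex.I) * (Real.exp (-(2 * Real.pi * a)) : ℂ))) /
        (2 * (2 * Real.pi * a) : ℂ)))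
    (hG : ∀ u : ℝ, G u = Complex.exp (2 * Real.pi * β * (⌊u⌋ : ℝ) * Complex.I) * K (u - ⌊u⌋)) :
    ‖∫ s in (0 : ℝ)..θ, (Real.cos (ω * (θ - s)) : ℂ) *
        ∫ y in (-(1 / 2 : ℝ))..(1 / 2 : ℝ), G ((-(1 / 4 : ℝ)) - y) * Complex.exp (((2 * Real.pi * ξ * y : ℝ) : ℂ) * Complex.I) * Complex.exp (-((2 * Real.pi * a * s * triWave y : ℝ) : ℂ) * Complex.I)‖ ≤
      ((‖((1 : ℂ) * (-1 / ((1 - starRingEnd ℂ (Complex.exp (2 * Real.pi * β * Complex.I)) * (Real.exp (-(2 * Real.pi * a)) : ℂ)) * (2 * (2 * Real.pi * a)))) * Complex.exp (-((2 * Real.pi * a : ℝ) : ℂ) * (-(1 / 4 : ℝ))))‖ * Real.exp ((2 * Real.pi * a) * (-(1 / 4 : ℝ))) * (2 + Real.pi) / |(2 * Real.pi * a)| * (1 / |(Real.pi * a) + (2 * Real.pi * a) * (-(1 / 4 : ℝ)) - ω| + 1 / |(Real.pi * a) + (2 * Real.pi * a) * (-(1 / 4 : ℝ)) + ω|) * (1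 / 2) +
        ‖((1 : ℂ) * (-1 / ((1 - starRingEnd ℂ (Complex.exp (2 * Real.pi * β * Complex.I)) * (Real.exp (-(2 * Real.pi * a)) : ℂ)) * (2 * (2 * Real.pi * a)))) * Complex.exp (-((2 * Real.pi * a : ℝ) : ℂ) * (-(1 / 4 : ℝ))))‖ * Real.exp ((2 * Real.pi * a) * (-(1 / 2 : ℝ))) * (2 + Real.pi) / |(2 * Real.pi * a)| * (1 / |(Real.pi * a) + (2 * Real.pi * a) * (-(1 / 2 : ℝ)) - ω| + 1 / |(Real.pi * a) + (2 * Real.pi * a) * (-(1 / 2 : ℝ)) + ω|) * (1 / 2)) +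
      (‖((1 : ℂ) * (-(Complex.exp (2 * Real.pi * β * Complex.I) * (Real.exp (-(2 * Real.pi * a)) : ℂ)) / ((1 - Complex.exp (2 * Real.pi * β * Complex.I) * (Real.exp (-(2 * Real.pi * a)) : ℂ)) * (2 * (2 * Real.pi * a)))) * Complex.exp (((2 * Real.pi * a : ℝ) : ℂ) * (-(1 / 4 : ℝ))))‖ * Real.exp ((-(2 * Real.pi * a)) * (-(1 / 4 : ℝ))) * (2 + Real.pi) / |(-(2 * Real.pi * a))| * (1 / |(Real.pi * a) + (2 * Real.pi * a) * (-(1 / 4 : ℝ)) - ω| + 1 / |(Real.pi * a) + (2 * Real.pi * a) * (-(1 / 4 : ℝ)) + ω|) * (1 / 2) +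
        ‖((1 : ℂ) * (-(Complex.exp (2 * Real.pi * β * Complex.I) * (Real.exp (-(2 * Real.pi * a)) : ℂ)) / ((1 - Complex.exp (2 * Real.pi * β * Complex.I) * (Real.exp (-(2 * Real.pi * a)) : ℂ)) * (2 * (2 * Real.pi * a)))) * Complex.exp (((2 * Real.pi * a : ℝ) : ℂ) * (-(1 / 4 : ℝ))))‖ * Real.exp ((-(2 * Real.pi * a)) * (-(1 / 2 : ℝ))) * (2 + Real.pi) / |(-(2 * Real.pi * a))| * (1 / |(Real.pi * a) + (2 * Real.pi * a) * (-(1 / 2 : ℝ)) - ω| + 1 / |(Real.pi * a) + (2 * Real.pi * a) * (-(1 / 2 : ℝ)) + ω|) * (1 / 2))) +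
      ((‖((starRingEnd ℂ (Complex.exp (2 * Real.pi * β * Complex.I))) * (-1 / ((1 - starRingEnd ℂ (Complex.exp (2 * Real.pi * β * Complex.I)) * (Real.exp (-(2 * Real.pi * a)) : ℂ)) * (2 * (2 * Real.pi * a)))) * Complex.exp (-((2 * Real.pi * a : ℝ) : ℂ) * (3 / 4 : ℝ)))‖ * Real.exp ((2 * Real.pi * a) * (1 / 4 : ℝ)) * (2 + Real.pi) / |(2 * Real.pi * a)| * (1 / |(0 : ℝ) + (-(2 * Real.pi * a)) * (1 / 4 : ℝ) - ω| + 1 / |(0 : ℝ) + (-(2 * Real.pi * a)) * (1 / 4 : ℝ) + ω|) * (1 / 2) +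
        ‖((starRingEnd ℂ (Complex.exp (2 * Real.pi * β * Complex.I))) * (-1 / ((1 - starRingEnd ℂ (Complex.exp (2 * Real.pi * β * Complex.I)) * (Real.exp (-(2 * Real.pi * a)) : ℂ)) * (2 * (2 * Real.pi * a)))) * Complex.exp (-((2 * Real.pi * a : ℝ) : ℂ) * (3 / 4 : ℝ)))‖ * Real.exp ((2 * Real.pi * a) * (-(1 / 4 : ℝ))) * (2 + Real.pi) / |(2 * Real.pi * a)| * (1 / |(0 : ℝ) + (-(2 * Real.pi * a)) * (-(1 / 4 : ℝ)) - ω| + 1 / |(0 : ℝ) + (-(2 * Real.pi * a)) * (-(1 / 4 : ℝ)) + ω|) * (1 / 2)) +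
      (‖((starRingEnd ℂ (Complex.exp (2 * Real.pi * β * Complex.I))) * (-(Complex.exp (2 * Real.pi * β * Complex.I) * (Real.exp (-(2 * Real.pi * a)) : ℂ)) / ((1 - Complex.exp (2 * Real.pi * β * Complex.I) * (Real.exp (-(2 * Real.pi * a)) : ℂ)) * (2 * (2 * Real.pi * a)))) * Complex.exp (((2 * Real.pi * a : ℝ) : ℂ) * (3 / 4 : ℝ)))‖ * Real.exp ((-(2 * Real.pi * a)) * (1 / 4 : ℝ)) * (2 + Real.pi) / |(-(2 * Real.pi * a))| * (1 / |(0 : ℝ) + (-(2 * Real.pi * a)) * (1 / 4 : ℝ) - ω| + 1 / |(0 : ℝ) + (-(2 * Real.pi * a)) * (1 / 4 : ℝ) + ω|) * (1 / 2) +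
        ‖((starRingEnd ℂ (Complex.exp (2 * Real.pi * β * Complex.I))) * (-(Complex.exp (2 * Real.pi * β * Complex.I) * (Real.exp (-(2 * Real.pi * a)) : ℂ)) / ((1 - Complex.exp (2 * Real.pi * β * Complex.I) * (Real.exp (-(2 * Real.pi * a)) : ℂ)) * (2 * (2 * Real.pi * a)))) * Complex.exp (((2 * Real.pi * a : ℝ) : ℂ) * (3 / 4 : ℝ)))‖ * Real.exp ((-(2 * Real.pi * a)) * (-(1 / 4 : ℝ))) * (2 + Real.pi) / |(-(2 * Real.pi * a))| * (1 / |(0 : ℝ) + (-(2 * Real.pi * a)) * (-(1 / 4 : ℝ)) - ω| + 1 / |(0 : ℝ) + (-(2 * Real.pi * a)) * (-(1 / 4 : ℝ)) + ω|) * (1 / 2))) +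
      ((‖((starRingEnd ℂ (Complex.exp (2 * Real.pi * β * Complex.I))) * (-1 / ((1 - starRingEnd ℂ (Complex.exp (2 * Real.pi * β * Complex.I)) * (Real.exp (-(2 * Real.pi * a)) : ℂ)) * (2 * (2 * Real.pi * a)))) * Complex.exp (-((2 * Real.pi * a : ℝ) : ℂ) * (3 / 4 : ℝ)))‖ * Real.exp ((2 * Real.pi * a) * (1 / 2 : ℝ)) * (2 + Real.pi) / |(2 * Real.pi * a)| * (1 / |(-(Real.pi * a)) + (2 * Real.pi * a) * (1 / 2 : ℝ) - ω| + 1 / |(-(Real.pi * a)) + (2 * Real.pi * a) * (1 / 2 : ℝ) + ω|) * (1 / 2) +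
        ‖((starRingEnd ℂ (Complex.exp (2 * Real.pi * β * Complex.I))) * (-1 / ((1 - starRingEnd ℂ (Complex.exp (2 * Real.pi * β * Complex.I)) * (Real.exp (-(2 * Real.pi * a)) : ℂ)) * (2 * (2 * Real.pi * a)))) * Complex.exp (-((2 * Real.pi * a : ℝ) : ℂ) * (3 / 4 : ℝ)))‖ * Real.exp ((2 * Real.pi * a) * (1 / 4 : ℝ)) * (2 + Real.pi) / |(2 * Real.pi * a)| * (1 / |(-(Real.pi * a)) + (2 * Real.pi * a) * (1 / 4 : ℝ) - ω| + 1 / |(-(Real.pi * a)) + (2 * Real.pi * a) * (1 / 4 : ℝ) + ω|) * (1 / 2)) +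
      (‖((starRingEnd ℂ (Complex.exp (2 * Real.pi * β * Complex.I))) * (-(Complex.exp (2 * Real.pi * β * Complex.I) * (Real.exp (-(2 * Real.pi * a)) : ℂ)) / ((1 - Complex.exp (2 * Real.pi * β * Complex.I) * (Real.exp (-(2 * Real.pi * a)) : ℂ)) * (2 * (2 * Real.pi * a)))) * Complex.exp (((2 * Real.pi * a : ℝ) : ℂ) * (3 / 4 : ℝ)))‖ * Real.exp ((-(2 * Real.pi * a)) * (1 / 2 : ℝ)) * (2 + Real.pi) / |(-(2 * Real.pi * a))| * (1 / |(-(Real.pi * a)) + (2 * Real.pi * a) * (1 / 2 : ℝ) - ω| + 1 / |(-(Real.pi * a)) + (2 * Real.pi * a) * (1 / 2 : ℝ) + ω|) * (1 / 2) +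
        ‖((starRingEnd ℂ (Complex.exp (2 * Real.pi * β * Complex.I))) * (-(Complex.exp (2 * Real.pi * β * Complex.I) * (Real.exp (-(2 * Real.pi * a)) : ℂ)) / ((1 - Complex.exp (2 * Real.pi * β * Complex.I) * (Real.exp (-(2 * Real.pi * a)) : ℂ)) * (2 * (2 * Real.pi * a)))) * Complex.exp (((2 * Real.pi * a : ℝ) : ℂ) * (3 / 4 : ℝ)))‖ * Real.exp ((-(2 * Real.pi * a)) * (1 / 4 : ℝ)) * (2 + Real.pi) / |(-(2 * Real.pi * a))| * (1 / |(-(Real.pi * a)) + (2 * Real.pi * a) * (1 / 4 : ℝ) - ω| + 1 / |(-(Real.pi * a)) + (2 * Real.pi * a) * (1 / 4 : ℝ) + ω|) * (1 / 2))) := by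
  have hμ1 : (2 * Real.pi * a : ℝ) ≠ 0 := by positivity
  have hμ2 : (-(2 * Real.pi * a) : ℝ) ≠ 0 := by
    have : (0:ℝ) < 2 * Real.pi * a := by positivity
    linarith
  simp_rw [src_negQuarter_pieces ha β ξ hK hG]
  have hc : ∀ (φ₀ : ℝ) (c₁ c₂ : ℂ) (ν y₁ y₂ : ℝ), Continuous fun s : ℝ => (Real.cos (ω * (θ - s)) : ℂ) *
      (Complex.exp (((φ₀ * s : ℝ)) * Complex.I) *
        (c₁ * ((Complex.exp ((((((2 * Real.pi * a) : ℝ)) : ℂ) + ((((2 * Real.pi * ξ) + ν * s : ℝ)) : ℂ) * Complex.I) * y₂) - Complex.exp ((((((2 * Real.pi * a) : ℝ)) : ℂ) + ((((2 * Real.pi * ξ) + ν * s : ℝ)) : ℂ) * Complex.I) * y₁)) / (((((2 * Real.pi * a) : ℝ)) : ℂ) + ((((2 * Real.pi * ξ) + ν * s : ℝ)) : ℂ) * Complex.I)) +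
         c₂ * ((Complex.exp ((((((-(2 * Real.pi * a)) : ℝ)) : ℂ) + ((((2 * Real.pi * ξ) + ν * s : ℝ)) : ℂ) * Complex.I) * y₂) - Complex.exp ((((((-(2 * Real.pi * a)) : ℝ)) : ℂ) + ((((2 * Real.pi * ξ) + ν * s : ℝ)) : ℂ) * Complex.I) * y₁)) / (((((-(2 * Real.pi * a)) : ℝ)) : ℂ) + ((((2 * Real.pi * ξ) + ν * s : ℝ)) : ℂ) * Complex.I)))) := by
    intro φ₀ c₁ c₂ ν y₁ y₂
    have d1 : ∀ s : ℝ, ((((2 * Real.pi * a) : ℝ)) : ℂ) + ((((2 * Real.pi * ξ) + ν * s : ℝ)) : ℂ) * Complex.I ≠ 0 := fun s => lorentz_denom_ne_zero hμ1 _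
    have d2 : ∀ s : ℝ, ((((-(2 * Real.pi * a)) : ℝ)) : ℂ) + ((((2 * Real.pi * ξ) + ν * s : ℝ)) : ℂ) * Complex.I ≠ 0 := fun s => lorentz_denom_ne_zero hμ2 _
    refine Continuous.mul (by fun_prop) (Continuous.mul (by fun_prop) (Continuous.add ?_ ?_))
    · exact continuous_const.mul (Continuous.div (by fun_prop) (by fun_prop) d1)
    · exact continuous_const.mul (Continuous.div (by fun_prop) (by fun_prop) d2)
  refine (norm_integral_three_le ?_ ?_ ?_).trans ?_
  · exact (hc (Real.pi * a) (((1 : ℂ) * (-1 / ((1 - starRingEnd ℂ (Complex.exp (2 * Real.pi * β * Complex.I)) * (Real.exp (-(2 * Real.pi * a)) : ℂ)) * (2 * (2 * Real.pi * a)))) * Complex.exp (-((2 * Real.pi * a : ℝ) : ℂ) * (-(1 / 4 : ℝ))))) (((1 : ℂ) * (-(Complex.exp (2 * Real.pi * β * Complex.I) * (Real.exp (-(2 * Real.pi * a)) : ℂ)) / ((1 - Complex.exp (2 * Real.pi * β * Complex.I) * (Real.exp (-(2 * Real.pi * a)) : ℂ)) * (2 * (2 * Real.pi * a)))) * Complex.exp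 (((2 * Real.pi * a : ℝ) : ℂ) * (-(1 / 4 : ℝ))))) (2 * Real.pi * a) (-(1 / 2 : ℝ)) (-(1 / 4 : ℝ))).intervalIntegrable (μ := volume) _ _
  · exact (hc (0 : ℝ) (((starRingEnd ℂ (Complex.exp (2 * Real.pi * β * Complex.I))) * (-1 / ((1 - starRingEnd ℂ (Complex.exp (2 * Real.pi * β * Complex.I)) * (Real.exp (-(2 * Real.pi * a)) : ℂ)) * (2 * (2 * Real.pi * a)))) * Complex.exp (-((2 * Real.pi * a : ℝ) : ℂ) * (3 / 4 : ℝ)))) (((starRingEnd ℂ (Complex.exp (2 * Real.pi * β * Complex.I))) * (-(Complex.exp (2 * Real.pi * β * Complex.I) * (Real.exp (-(2 * Real.pi * a)) : ℂ)) / ((1 - Complex.exp (2 * Real.pi * β * Complex.I) * (Real.exp (-(2 * Real.pi * a)) : ℂ)) * (2 * (2 * Real.pi * a)))) * Complex.exp (((2 * Real.pi * a : ℝ) : ℂ) * (3 / 4 : ℝ)))) (-(2 * Real.pi * a)) (-(1 / 4 : ℝ)) (1 / 4 : ℝ)).intervalIntegrable (μ := volume) _ _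
  · exact (hc (-(Real.pi * a)) (((starRingEnd ℂ (Complex.exp (2 * Real.pi * β * Complex.I))) * (-1 / ((1 - starRingEnd ℂ (Complex.exp (2 * Real.pi * β * Complex.I)) * (Real.exp (-(2 * Real.pi * a)) : ℂ)) * (2 * (2 * Real.pi * a)))) * Complex.exp (-((2 * Real.pi * a : ℝ) : ℂ) * (3 / 4 : ℝ)))) (((starRingEnd ℂ (Complex.exp (2 * Real.pi * β * Complex.I))) * (-(Complex.exp (2 * Real.pi * β * Complex.I) * (Real.exp (-(2 * Real.pi * a)) : ℂ)) / ((1 - Complex.exp (2 * Real.pi * β * Complex.I) * (Real.exp (-(2 * Real.pi * a)) : ℂ)) * (2 * (2 * Real.pi * a)))) * Complex.exp (((2 * Real.pi * a : ℝ) : ℂ) * (3 / 4 : ℝ)))) (2 * Real.pi * a) (1 / 4 : ℝ) (1 / 2 : ℝ)).intervalIntegrable (μ := volume) _ _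
  · exact add_le_add (add_le_add
      (norm_integral_cos_piece_le (ω := ω) hθ (((1 : ℂ) * (-1 / ((1 - starRingEnd ℂ (Complex.exp (2 * Real.pi * β * Complex.I)) * (Real.exp (-(2 * Real.pi * a)) : ℂ)) * (2 * (2 * Real.pi * a)))) * Complex.exp (-((2 * Real.pi * a : ℝ) : ℂ) * (-(1 / 4 : ℝ))))) (((1 : ℂ) * (-(Complex.exp (2 * Real.pi * β * Complex.I) * (Real.exp (-(2 * Real.pi * a)) : ℂ)) / ((1 - Complex.exp (2 * Real.pi * β * Complex.I) * (Real.exp (-(2 * Real.pi * a)) : ℂ)) * (2 * (2 * Real.pi * a)))) * Complex.exp (((2 * Real.pi * a : ℝ) : ℂ) * (-(1 / 4 : ℝ))))) hμ1 hμ2 (2 * Real.pi * ξ) (2 * Real.pi * a) (Real.pi * a) (-(1 / 2 : ℝ)) (-(1 / 4 : ℝ)) (by intro h; apply hω; linarith) (by intro h; apply hω; linarith) (by intro h; apply hω1; linarith) (by intro h; apply hω2; linarith))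
      (norm_integral_cos_piece_le (ω := ω) hθ (((starRingEnd ℂ (Complex.exp (2 * Real.pi * β * Complex.I))) * (-1 / ((1 - starRingEnd ℂ (Complex.exp (2 * Real.pi * β * Complex.I)) * (Real.exp (-(2 * Real.pi * a)) : ℂ)) * (2 * (2 * Real.pi * a)))) * Complex.exp (-((2 * Real.pi * a : ℝ) : ℂ) * (3 / 4 : ℝ)))) (((starRingEnd ℂ (Complex.exp (2 * Real.pi * β * Complex.I))) * (-(Complex.exp (2 * Real.pi * β * Complex.I) * (Real.exp (-(2 * Real.pi * a)) : ℂ)) / ((1 - Complex.exp (2 * Real.pi * β * Complex.I) * (Real.exp (-(2 * Real.pi * a)) : ℂ)) * (2 * (2 * Real.pi * a)))) * Complex.exp (((2 * Real.pi * a : ℝ) : ℂ) * (3 / 4 : ℝ)))) hμ1 hμ2 (2 * Real.pi * ξ) (-(2 * Real.pi * a)) (0 : ℝ) (-(1 / 4 : ℝ)) (1 / 4 : ℝ) (by intro h; apply hω1; linarith) (by intro h; apply hω2; linarith) (by intro h; apply hω2; linarith) (by intro h; apply hω1; linarith)))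
      (norm_integral_cos_piece_le (ω := ω) hθ (((starRingEnd ℂ (Complex.exp (2 * Real.pi * β * Complex.I))) * (-1 / ((1 - starRingEnd ℂ (Complex.exp (2 * Real.pi * β * Complex.I)) * (Real.exp (-(2 * Real.pi * a)) : ℂ)) * (2 * (2 * Real.pi * a)))) * Complex.exp (-((2 * Real.pi * a : ℝ) : ℂ) * (3 / 4 : ℝ)))) (((starRingEnd ℂ (Complex.exp (2 * Real.pi * β * Complex.I))) * (-(Complex.exp (2 * Real.pi * β * Complex.I) * (Real.exp (-(2 * Real.pi * a)) : ℂ)) / ((1 - Complex.exp (2 * Real.pi * β * Complex.I) * (Real.exp (-(2 * Real.pi * a)) : ℂ)) * (2 * (2 * Real.pi * a)))) * Complex.exp (((2 * Real.pi * a : ℝ) : ℂ) * (3 / 4 : ℝ)))) hμ1 hμ2 (2 * Real.pi * ξ) (2 * Real.pi * a) (-(Real.pi * a)) (1 / 4 : ℝ) (1 / 2 : ℝ) (by intro h; apply hω2; linarith) (by intro h; apply hω1; linarith) (by intro h; apply hω; linarith) (by intro h; apply hω; linarith))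


/-- **Response of the `sin` propagator entry to the single-mode source at `y₀ = −¼`** (`a > 0`, `θ ≥ 0`, `ω ∉ {0, ±πa/2}`): the twelve-term bound,
uniform in `θ` and `ξ`. [cite: Drazin2002, §8.3 (8.36)–(8.38)] -/
theorem norm_integral_sin_src_negQuarter_le (ha : 0 < a) (β ξ : ℝ) {ω θ : ℝ} (hθ : 0 ≤ θ) (hω : ω ≠ 0)
    (hω1 : Real.pi * a / 2 - ω ≠ 0) (hω2 : Real.pi * a / 2 + ω ≠ 0)
    (hK : K = fun r : ℝ => (-((Real.exp (-(2 * Real.pi * a * r)) : ℂ) /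
            (1 - starRingEnd ℂ (Complex.exp (2 * Real.pi * β * Complex.I)) * (Real.exp (-(2 * Real.pi * a)) : ℂ))
          + (Real.exp (2 * Real.pi * a * (r - 1)) : ℂ) * Complex.exp (2 * Real.pi * β * Complex.I) /
            (1 - Complex.exp (2 * Real.pi * β * Complex.I) * (Real.exp (-(2 * Real.pi * a)) : ℂ))) /
        (2 * (2 * Real.pi * a) : ℂ)))
    (hG : ∀ u : ℝ, G u = Complex.exp (2 * Real.pi * β * (⌊u⌋ : ℝ) * Complex.I) * K (u - ⌊u⌋)) :
    ‖∫ s in (0 : ℝ)..θ, ((Real.sin (ω * (θ - s)) / ω : ℝ) : ℂ) *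
        ∫ y in (-(1 / 2 : ℝ))..(1 / 2 : ℝ), G ((-(1 / 4 : ℝ)) - y) * Complex.exp (((2 * Real.pi * ξ * y : ℝ) : ℂ) * Complex.I) * Complex.exp (-((2 * Real.pi * a * s * triWave y : ℝ) : ℂ) * Complex.I)‖ ≤
      ((‖((1 : ℂ) * (-1 / ((1 - starRingEnd ℂ (Complex.exp (2 * Real.pi * β * Complex.I)) * (Real.exp (-(2 * Real.pi * a)) : ℂ)) * (2 * (2 * Real.pi * a)))) * Complex.exp (-((2 * Real.pi * a : ℝ) : ℂ) * (-(1 / 4 : ℝ))))‖ * Real.exp ((2 * Real.pi * a) * (-(1 / 4 : ℝ))) * (2 + Real.pi) / |(2 * Real.pi * a)| * (1 / |(Real.pi * a) + (2 * Real.pi * a) * (-(1 / 4 : ℝ)) - ω| + 1 / |(Real.pi * a) + (2 * Real.pi * a) * (-(1 / 4 : ℝ)) + ω|) * (1 / (2 * |ω|)) +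
        ‖((1 : ℂ) * (-1 / ((1 - starRingEnd ℂ (Complex.exp (2 * Real.pi * β * Complex.I)) * (Real.exp (-(2 * Real.pi * a)) : ℂ)) * (2 * (2 * Real.pi * a)))) * Complex.exp (-((2 * Real.pi * a : ℝ) : ℂ) * (-(1 / 4 : ℝ))))‖ * Real.exp ((2 * Real.pi * a) * (-(1 / 2 : ℝ))) * (2 + Real.pi) / |(2 * Real.pi * a)| * (1 / |(Real.pi * a) + (2 * Real.pi * a) * (-(1 / 2 : ℝ)) - ω| + 1 / |(Real.pi * a) + (2 * Real.pi * a) * (-(1 / 2 : ℝ)) + ω|) * (1 / (2 * |ω|))) +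
      (‖((1 : ℂ) * (-(Complex.exp (2 * Real.pi * β * Complex.I) * (Real.exp (-(2 * Real.pi * a)) : ℂ)) / ((1 - Complex.exp (2 * Real.pi * β * Complex.I) * (Real.exp (-(2 * Real.pi * a)) : ℂ)) * (2 * (2 * Real.pi * a)))) * Complex.exp (((2 * Real.pi * a : ℝ) : ℂ) * (-(1 / 4 : ℝ))))‖ * Real.exp ((-(2 * Real.pi * a)) * (-(1 / 4 : ℝ))) * (2 + Real.pi) / |(-(2 * Real.pi * a))| * (1 / |(Real.pi * a) + (2 * Real.pi * a) * (-(1 / 4 : ℝ)) - ω| + 1 / |(Real.pi * a) + (2 * Real.pi * a) * (-(1 / 4 : ℝ)) + ω|) * (1 / (2 * |ω|)) +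
        ‖((1 : ℂ) * (-(Complex.exp (2 * Real.pi * β * Complex.I) * (Real.exp (-(2 * Real.pi * a)) : ℂ)) / ((1 - Complex.exp (2 * Real.pi * β * Complex.I) * (Real.exp (-(2 * Real.pi * a)) : ℂ)) * (2 * (2 * Real.pi * a)))) * Complex.exp (((2 * Real.pi * a : ℝ) : ℂ) * (-(1 / 4 : ℝ))))‖ * Real.exp ((-(2 * Real.pi * a)) * (-(1 / 2 : ℝ))) * (2 + Real.pi) / |(-(2 * Real.pi * a))| * (1 / |(Real.pi * a) + (2 * Real.pi * a) * (-(1 / 2 : ℝ)) - ω| + 1 / |(Real.pi * a) + (2 * Real.pi * a) * (-(1 / 2 : ℝ)) + ω|) * (1 / (2 * |ω|)))) +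
      ((‖((starRingEnd ℂ (Complex.exp (2 * Real.pi * β * Complex.I))) * (-1 / ((1 - starRingEnd ℂ (Complex.exp (2 * Real.pi * β * Complex.I)) * (Real.exp (-(2 * Real.pi * a)) : ℂ)) * (2 * (2 * Real.pi * a)))) * Complex.exp (-((2 * Real.pi * a : ℝ) : ℂ) * (3 / 4 : ℝ)))‖ * Real.exp ((2 * Real.pi * a) * (1 / 4 : ℝ)) * (2 + Real.pi) / |(2 * Real.pi * a)| * (1 / |(0 : ℝ) + (-(2 * Real.pi * a)) * (1 / 4 : ℝ) - ω| + 1 / |(0 : ℝ) + (-(2 * Real.pi * a)) * (1 / 4 : ℝ) + ω|) * (1 / (2 * |ω|)) +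
        ‖((starRingEnd ℂ (Complex.exp (2 * Real.pi * β * Complex.I))) * (-1 / ((1 - starRingEnd ℂ (Complex.exp (2 * Real.pi * β * Complex.I)) * (Real.exp (-(2 * Real.pi * a)) : ℂ)) * (2 * (2 * Real.pi * a)))) * Complex.exp (-((2 * Real.pi * a : ℝ) : ℂ) * (3 / 4 : ℝ)))‖ * Real.exp ((2 * Real.pi * a) * (-(1 / 4 : ℝ))) * (2 + Real.pi) / |(2 * Real.pi * a)| * (1 / |(0 : ℝ) + (-(2 * Real.pi * a)) * (-(1 / 4 : ℝ)) - ω| + 1 / |(0 : ℝ) + (-(2 * Real.pi * a)) * (-(1 / 4 : ℝ)) + ω|) * (1 / (2 * |ω|))) +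
      (‖((starRingEnd ℂ (Complex.exp (2 * Real.pi * β * Complex.I))) * (-(Complex.exp (2 * Real.pi * β * Complex.I) * (Real.exp (-(2 * Real.pi * a)) : ℂ)) / ((1 - Complex.exp (2 * Real.pi * β * Complex.I) * (Real.exp (-(2 * Real.pi * a)) : ℂ)) * (2 * (2 * Real.pi * a)))) * Complex.exp (((2 * Real.pi * a : ℝ) : ℂ) * (3 / 4 : ℝ)))‖ * Real.exp ((-(2 * Real.pi * a)) * (1 / 4 : ℝ)) * (2 + Real.pi) / |(-(2 * Real.pi * a))| * (1 / |(0 : ℝ) + (-(2 * Real.pi * a)) * (1 / 4 : ℝ) - ω| + 1 / |(0 : ℝ) + (-(2 * Real.pi * a)) * (1 / 4 : ℝ) + ω|) * (1 / (2 * |ω|)) +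
        ‖((starRingEnd ℂ (Complex.exp (2 * Real.pi * β * Complex.I))) * (-(Complex.exp (2 * Real.pi * β * Complex.I) * (Real.exp (-(2 * Real.pi * a)) : ℂ)) / ((1 - Complex.exp (2 * Real.pi * β * Complex.I) * (Real.exp (-(2 * Real.pi * a)) : ℂ)) * (2 * (2 * Real.pi * a)))) * Complex.exp (((2 * Real.pi * a : ℝ) : ℂ) * (3 / 4 : ℝ)))‖ * Real.exp ((-(2 * Real.pi * a)) * (-(1 / 4 : ℝ))) * (2 + Real.pi) / |(-(2 * Real.pi * a))| * (1 / |(0 : ℝ) + (-(2 * Real.pi * a)) * (-(1 / 4 : ℝ)) - ω| + 1 / |(0 : ℝ) + (-(2 * Real.pi * a)) * (-(1 / 4 : ℝ)) + ω|) * (1 / (2 * |ω|)))) +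
      ((‖((starRingEnd ℂ (Complex.exp (2 * Real.pi * β * Complex.I))) * (-1 / ((1 - starRingEnd ℂ (Complex.exp (2 * Real.pi * β * Complex.I)) * (Real.exp (-(2 * Real.pi * a)) : ℂ)) * (2 * (2 * Real.pi * a)))) * Complex.exp (-((2 * Real.pi * a : ℝ) : ℂ) * (3 / 4 : ℝ)))‖ * Real.exp ((2 * Real.pi * a) * (1 / 2 : ℝ)) * (2 + Real.pi) / |(2 * Real.pi * a)| * (1 / |(-(Real.pi * a)) + (2 * Real.pi * a) * (1 / 2 : ℝ) - ω| + 1 / |(-(Real.pi * a)) + (2 * Real.pi * a) * (1 / 2 : ℝ) + ω|) * (1 / (2 * |ω|)) +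
        ‖((starRingEnd ℂ (Complex.exp (2 * Real.pi * β * Complex.I))) * (-1 / ((1 - starRingEnd ℂ (Complex.exp (2 * Real.pi * β * Complex.I)) * (Real.exp (-(2 * Real.pi * a)) : ℂ)) * (2 * (2 * Real.pi * a)))) * Complex.exp (-((2 * Real.pi * a : ℝ) : ℂ) * (3 / 4 : ℝ)))‖ * Real.exp ((2 * Real.pi * a) * (1 / 4 : ℝ)) * (2 + Real.pi) / |(2 * Real.pi * a)| * (1 / |(-(Real.pi * a)) + (2 * Real.pi * a) * (1 / 4 : ℝ) - ω| + 1 / |(-(Real.pi * a)) + (2 * Real.pi * a) * (1 / 4 : ℝ) + ω|) * (1 / (2 * |ω|))) +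
      (‖((starRingEnd ℂ (Complex.exp (2 * Real.pi * β * Complex.I))) * (-(Complex.exp (2 * Real.pi * β * Complex.I) * (Real.exp (-(2 * Real.pi * a)) : ℂ)) / ((1 - Complex.exp (2 * Real.pi * β * Complex.I) * (Real.exp (-(2 * Real.pi * a)) : ℂ)) * (2 * (2 * Real.pi * a)))) * Complex.exp (((2 * Real.pi * a : ℝ) : ℂ) * (3 / 4 : ℝ)))‖ * Real.exp ((-(2 * Real.pi * a)) * (1 / 2 : ℝ)) * (2 + Real.pi) / |(-(2 * Real.pi * a))| * (1 / |(-(Real.pi * a)) + (2 * Real.pi * a) * (1 / 2 : ℝ) - ω| + 1 / |(-(Real.pi * a)) + (2 * Real.pi * a) * (1 / 2 : ℝ) + ω|) * (1 / (2 * |ω|)) +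
        ‖((starRingEnd ℂ (Complex.exp (2 * Real.pi * β * Complex.I))) * (-(Complex.exp (2 * Real.pi * β * Complex.I) * (Real.exp (-(2 * Real.pi * a)) : ℂ)) / ((1 - Complex.exp (2 * Real.pi * β * Complex.I) * (Real.exp (-(2 * Real.pi * a)) : ℂ)) * (2 * (2 * Real.pi * a)))) * Complex.exp (((2 * Real.pi * a : ℝ) : ℂ) * (3 / 4 : ℝ)))‖ * Real.exp ((-(2 * Real.pi * a)) * (1 / 4 : ℝ)) * (2 + Real.pi) / |(-(2 * Real.pi * a))| * (1 / |(-(Real.pi * a)) + (2 * Real.pi * a) * (1 / 4 : ℝ) - ω| + 1 / |(-(Real.pi * a)) + (2 * Real.pi * a) * (1 / 4 : ℝ) + ω|) * (1 / (2 * |ω|)))) := by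
  have hμ1 : (2 * Real.pi * a : ℝ) ≠ 0 := by positivity
  have hμ2 : (-(2 * Real.pi * a) : ℝ) ≠ 0 := by
    have : (0:ℝ) < 2 * Real.pi * a := by positivity
    linarith
  simp_rw [src_negQuarter_pieces ha β ξ hK hG]
  have hc : ∀ (φ₀ : ℝ) (c₁ c₂ : ℂ) (ν y₁ y₂ : ℝ), Continuous fun s : ℝ => ((Real.sin (ω * (θ - s)) / ω : ℝ) : ℂ) *
      (Complex.exp (((φ₀ * s : ℝ)) * Complex.I) *
        (c₁ * ((Complex.exp ((((((2 * Real.pi * a) : ℝ)) : ℂ) + ((((2 * Real.pi * ξ) + ν * s : ℝ)) : ℂ) * Complex.I) * y₂) - Complex.exp ((((((2 * Real.pi * a) : ℝ)) : ℂ) + ((((2 * Real.pi * ξ) + ν * s : ℝ)) : ℂ) * Complex.I) * y₁)) / (((((2 * Real.pi * a) : ℝ)) : ℂ) + ((((2 * Real.pi * ξ) + ν * s : ℝ)) : ℂ) * Complex.I)) +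
         c₂ * ((Complex.exp ((((((-(2 * Real.pi * a)) : ℝ)) : ℂ) + ((((2 * Real.pi * ξ) + ν * s : ℝ)) : ℂ) * Complex.I) * y₂) - Complex.exp ((((((-(2 * Real.pi * a)) : ℝ)) : ℂ) + ((((2 * Real.pi * ξ) + ν * s : ℝ)) : ℂ) * Complex.I) * y₁)) / (((((-(2 * Real.pi * a)) : ℝ)) : ℂ) + ((((2 * Real.pi * ξ) + ν * s : ℝ)) : ℂ) * Complex.I)))) := by
    intro φ₀ c₁ c₂ ν y₁ y₂
    have d1 : ∀ s : ℝ, ((((2 * Real.pi * a) : ℝ)) : ℂ) + ((((2 * Real.pi * ξ) + ν * s : ℝ)) : ℂ) * Complex.I ≠ 0 := fun s => lorentz_denom_ne_zero hμ1 _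
    have d2 : ∀ s : ℝ, ((((-(2 * Real.pi * a)) : ℝ)) : ℂ) + ((((2 * Real.pi * ξ) + ν * s : ℝ)) : ℂ) * Complex.I ≠ 0 := fun s => lorentz_denom_ne_zero hμ2 _
    refine Continuous.mul (by fun_prop) (Continuous.mul (by fun_prop) (Continuous.add ?_ ?_))
    · exact continuous_const.mul (Continuous.div (by fun_prop) (by fun_prop) d1)
    · exact continuous_const.mul (Continuous.div (by fun_prop) (by fun_prop) d2)
  refine (norm_integral_three_le ?_ ?_ ?_).trans ?_
  · exact (hc (Real.pi * a) (((1 : ℂ) * (-1 / ((1 - starRingEnd ℂ (Complex.exp (2 * Real.pi * β * Complex.I)) * (Real.exp (-(2 * Real.pi * a)) : ℂ)) * (2 * (2 * Real.pi * a)))) * Complex.exp (-((2 * Real.pi * a : ℝ) : ℂ) * (-(1 / 4 : ℝ))))) (((1 : ℂ) * (-(Complex.exp (2 * Real.pi * β * Complex.I) * (Real.exp (-(2 * Real.pi * a)) : ℂ)) / ((1 - Complex.exp (2 * Real.pi * β * Complex.I) * (Real.exp (-(2 * Real.pi * a)) : ℂ)) * (2 * (2 * Real.pi * a)))) * Complex.exp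 (((2 * Real.pi * a : ℝ) : ℂ) * (-(1 / 4 : ℝ))))) (2 * Real.pi * a) (-(1 / 2 : ℝ)) (-(1 / 4 : ℝ))).intervalIntegrable (μ := volume) _ _
  · exact (hc (0 : ℝ) (((starRingEnd ℂ (Complex.exp (2 * Real.pi * β * Complex.I))) * (-1 / ((1 - starRingEnd ℂ (Complex.exp (2 * Real.pi * β * Complex.I)) * (Real.exp (-(2 * Real.pi * a)) : ℂ)) * (2 * (2 * Real.pi * a)))) * Complex.exp (-((2 * Real.pi * a : ℝ) : ℂ) * (3 / 4 : ℝ)))) (((starRingEnd ℂ (Complex.exp (2 * Real.pi * β * Complex.I))) * (-(Complex.exp (2 * Real.pi * β * Complex.I) * (Real.exp (-(2 * Real.pi * a)) : ℂ)) / ((1 - Complex.exp (2 * Real.pi * β * Complex.I) * (Real.exp (-(2 * Real.pi * a)) : ℂ)) * (2 * (2 * Real.pi * a)))) * Complex.exp (((2 * Real.pi * a : ℝ) : ℂ) * (3 / 4 : ℝ)))) (-(2 * Real.pi * a)) (-(1 / 4 : ℝ)) (1 / 4 : ℝ)).intervalIntegrable (μ := volume) _ _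
  · exact (hc (-(Real.pi * a)) (((starRingEnd ℂ (Complex.exp (2 * Real.pi * β * Complex.I))) * (-1 / ((1 - starRingEnd ℂ (Complex.exp (2 * Real.pi * β * Complex.I)) * (Real.exp (-(2 * Real.pi * a)) : ℂ)) * (2 * (2 * Real.pi * a)))) * Complex.exp (-((2 * Real.pi * a : ℝ) : ℂ) * (3 / 4 : ℝ)))) (((starRingEnd ℂ (Complex.exp (2 * Real.pi * β * Complex.I))) * (-(Complex.exp (2 * Real.pi * β * Complex.I) * (Real.exp (-(2 * Real.pi * a)) : ℂ)) / ((1 - Complex.exp (2 * Real.pi * β * Complex.I) * (Real.exp (-(2 * Real.pi * a)) : ℂ)) * (2 * (2 * Real.pi * a)))) * Complex.exp (((2 * Real.pi * a : ℝ) : ℂ) * (3 / 4 : ℝ)))) (2 * Real.pi * a) (1 / 4 : ℝ) (1 / 2 : ℝ)).intervalIntegrable (μ := volume) _ _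
  · exact add_le_add (add_le_add
      (norm_integral_sin_piece_le hω hθ (((1 : ℂ) * (-1 / ((1 - starRingEnd ℂ (Complex.exp (2 * Real.pi * β * Complex.I)) * (Real.exp (-(2 * Real.pi * a)) : ℂ)) * (2 * (2 * Real.pi * a)))) * Complex.exp (-((2 * Real.pi * a : ℝ) : ℂ) * (-(1 / 4 : ℝ))))) (((1 : ℂ) * (-(Complex.exp (2 * Real.pi * β * Complex.I) * (Real.exp (-(2 * Real.pi * a)) : ℂ)) / ((1 - Complex.exp (2 * Real.pi * β * Complex.I) * (Real.exp (-(2 * Real.pi * a)) : ℂ)) * (2 * (2 * Real.pi * a)))) * Complex.exp (((2 * Real.pi * a : ℝ) : ℂ) * (-(1 / 4 : ℝ))))) hμ1 hμ2 (2 * Real.pi * ξ) (2 * Real.pi * a) (Real.pi * a) (-(1 / 2 : ℝ)) (-(1 / 4 : ℝ)) (by intro h; apply hω; linarith) (by intro h; apply hω; linarith) (by intro h; apply hω1; linarith) (by intro h; apply hω2; linarith))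
      (norm_integral_sin_piece_le hω hθ (((starRingEnd ℂ (Complex.exp (2 * Real.pi * β * Complex.I))) * (-1 / ((1 - starRingEnd ℂ (Complex.exp (2 * Real.pi * β * Complex.I)) * (Real.exp (-(2 * Real.pi * a)) : ℂ)) * (2 * (2 * Real.pi * a)))) * Complex.exp (-((2 * Real.pi * a : ℝ) : ℂ) * (3 / 4 : ℝ)))) (((starRingEnd ℂ (Complex.exp (2 * Real.pi * β * Complex.I))) * (-(Complex.exp (2 * Real.pi * β * Complex.I) * (Real.exp (-(2 * Real.pi * a)) : ℂ)) / ((1 - Complex.exp (2 * Real.pi * β * Complex.I) * (Real.exp (-(2 * Real.pi * a)) : ℂ)) * (2 * (2 * Real.pi * a)))) * Complex.exp (((2 * Real.pi * a : ℝ) : ℂ) * (3 / 4 : ℝ)))) hμ1 hμ2 (2 * Real.pi * ξ) (-(2 * Real.pi * a)) (0 : ℝ) (-(1 / 4 : ℝ)) (1 / 4 : ℝ) (by intro h; apply hω1; linarith) (by intro h; apply hω2; linarith) (by intro h; apply hω2; linarith) (by intro h; apply hω1; linarith)))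
      (norm_integral_sin_piece_le hω hθ (((starRingEnd ℂ (Complex.exp (2 * Real.pi * β * Complex.I))) * (-1 / ((1 - starRingEnd ℂ (Complex.exp (2 * Real.pi * β * Complex.I)) * (Real.exp (-(2 * Real.pi * a)) : ℂ)) * (2 * (2 * Real.pi * a)))) * Complex.exp (-((2 * Real.pi * a : ℝ) : ℂ) * (3 / 4 : ℝ)))) (((starRingEnd ℂ (Complex.exp (2 * Real.pi * β * Complex.I))) * (-(Complex.exp (2 * Real.pi * β * Complex.I) * (Real.exp (-(2 * Real.pi * a)) : ℂ)) / ((1 - Complex.exp (2 * Real.pi * β * Complex.I) * (Real.exp (-(2 * Real.pi * a)) : ℂ)) * (2 * (2 * Real.pi * a)))) * Complex.exp (((2 * Real.pi * a : ℝ) : ℂ) * (3 / 4 : ℝ)))) hμ1 hμ2 (2 * Real.pi * ξ) (2 * Real.pi * a) (-(Real.pi * a)) (1 / 4 : ℝ) (1 / 2 : ℝ) (by intro h; apply hω2; linarith) (by intro h; apply hω1; linarith) (by intro h; apply hω; linarith) (by intro h; apply hω; linarith))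


end source

end Summit.AnomalousDissipation.AnomalousDissipation.Theorems.SawtoothPulseCascade.K2PhaseBudget

end
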